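import Summits.CriticalPhenomena.CardyFormulaZ2.Theses.CardyFlipRusso
import Literature.Probability.Percolation.SmirnovSeparatingData
import Literature.Probability.Percolation.SiteEmbDomainCrossing
import Literature.Probability.Percolation.VoronoiCrossing
import Literature.Probability.Percolation.VoronoiSeparating
import Literature.Probability.Percolation.VoronoiArmEstimates
import Literature.Probability.Percolation.SiteNestingWeightBound
import Literature.Probability.Percolation.TriApproxDomain
import Literature.Probability.Percolation.SmirnovSeparatingDataProofs
import Literature.Probability.RandomPlanarGeometry.ConformalRectangleProofs
import Literature.Topology.PlaneTopology.JordanSweepParity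
import Summits.CriticalPhenomena.CardyFormulaZ2.Theorems.CardyFlipRussoTargetStubEndgame
import Summits.CriticalPhenomena.CardyFormulaZ2.Theorems.CardyFlipRussoTargetStubGsDictionary
import Summits.CriticalPhenomena.CardyFormulaZ2.Theorems.CardyFlipRussoTargetStubFamiliesOfData
import Summits.CriticalPhenomena.CardyFormulaZ2.Theorems.CardyFlipRussoTargetStubVoronoiGrid
import Summits.CriticalPhenomena.CardyFormulaZ2.Theorems.CardyFlipRussoTargetStubVoronoiEquicont
import Summits.CriticalPhenomena.CardyFormulaZ2.Theorems.CardyFlipRussoTargetStubVoronoiBoundaryVanish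
import Summits.CriticalPhenomena.CardyFormulaZ2.Theorems.CardyFlipRussoTargetStubVoronoiCorner
import Summits.CriticalPhenomena.CardyFormulaZ2.Theorems.CardyFlipRussoTargetStubVoronoiBoundarySum
import Summits.CriticalPhenomena.CardyFormulaZ2.Theorems.UnionJackBeffaraUnionJackEndgame
import Summits.CriticalPhenomena.CardyFormulaZ2.Theorems.CardyFlipRussoCoveringLegRobust
import Summits.CriticalPhenomena.CardyFormulaZ2.Theorems.CardyFlipRussoCoveringLegStubFrameBridgeShift
import Literature.Probability.Percolation.CardyFormulaConformalInvariance
import Literature.Barriers.CriticalPhenomena.CoveringLatticeShift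
import HarnessLib.Audit.Check

/-!
# Line `Sketch` — CHECKED SKELETON (v7) for the crux `Target`
(item stmt-CriticalPhenomena-6431, rank-0 auto-crux of route `CardyFlipRusso`, sub-problem
`CardyFormulaZ2`; lead provers `prover-line-stmt-CriticalPhenomena-6431-0` (v1–v4, cycle 1),
`prover-line-stmt-CriticalPhenomena-6431-c1-0` (v5, cycle 2),
`prover-line-stmt-CriticalPhenomena-6431-c2-0` (v6, cycle 3) and
`prover-line-stmt-CriticalPhenomena-6431-c3-0` (v7, cycle 4), 2026-08-16/17; reshaped from the
crux-ideate sketch `Cruxes/Target/Sketch_6431_ideator1.lean` of card `delaunay-annealed-morera`)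

## v7 (cycle 4): folded signatures, honest implication stubs, the ∀-sequence reshape

* Every stub signature is FOLDED over the modules the hub has meanwhile built: the canonical data
  are `voronoiSepProb (PB.prod PW) (forgetLast R)` (`VoronoiSeparating.lean`, p107410; `vorSep`
  below is that term, `rfl`), the landed stubs 1, 2, 3e, 4 are IMPORTED from their `Theorems/`
  files instead of being repeated, and the two RSW-grade debts are the Literature NAMED FACTS
  `VoronoiAnnealedOneArm` (F1, Tassion 2016 Thm 3 (2)) and `VoronoiAnnealedBlackCircuit` (F2,
  Tassion 2016 §4) of `VoronoiArmEstimates.lean` (p114934): `stub_tassionEstimates : F1 ∧ F2` is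
  now literally the named-fact debt (discharging it = formalising Tassion 2016; XL, "What is
  missing" of the Census), and the skeleton is CLOSED MODULO it, the kernel, the colour-duality
  stub and the `G_s` stub.
* RESHAPE of the two remaining RSW-grade stubs into implications from F1 in ∀-SEQUENCE form (the
  glue, not the worker, chooses the face-centre sequences, by the pure-geometry lemma
  `exists_hexCenter_seq_tendsto` proved here): `stub_voronoiBoundary` (v5/v6) ↦
  `stub_voronoiBoundaryVanish` (F1 → `fⁱ(z_δ) → 0` along ANY `z_δ → z ∈ Aᵢ°` in `closure Ω`:
  one-arm at `z` + uniform local path-connectedness of `closure Ω`, `JordanDomainLocalJoin.lean`,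
  p114618) and `stub_voronoiBoundarySum` (`f^{i+1}(z_δ) + f^{i+2}(z_δ) → 1` along any `z_δ → z`
  in `Ω`; bare statement: its proof needs continuum black/white DUALITY for Voronoi crossings of a
  conformal rectangle + colour symmetry + F1 — the duality is where `p = 1/2` enters the boundary
  values; no tree fact yet); `stub_voronoiCorner` ↦ F1 → (40) along ANY `z_δ → d'` in `closure Ω`
  (one-arm at `d'` + local join + interlacing of paths in `closure Ω` via Schoenflies).
* Stubs (7 registered `sorry`s): `stub_voronoiCauchy` (KERNEL, conjecture-grade, lead),
  `stub_tassionEstimates` (named-fact debt F1 ∧ F2), `stub_voronoiEquicont` (F1 → F2 → Claim-22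
  estimate), `stub_voronoiBoundaryVanish` (F1 →), `stub_voronoiBoundarySum` (duality-grade),
  `stub_voronoiCorner` (F1 →), `stub_gsSepData` (⇔ conjunct (ii) ⇔ the open shared crux
  `UnionJackMorera`, stmt-CriticalPhenomena-4558, §5).

## v6 (cycle 3): structural facts for the planner, kernel-checked (§5)

The registered stubs and their signatures are UNCHANGED from v5.1 (the farm has still not built
`Literature.Probability.Percolation.VoronoiSeparating`, so `vorSep` stays unfolded textually, and the
landed `StubFamiliesOfData` / `StubVoronoiGrid` modules are not yet importable, so their proofs stay
inlined). New and sorry-free (§5): an `IsSeparatingData`-EXISTENTIAL interface is never smaller than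
the conjunct it feeds — `sepDataSandwich_of_hasCrossingLimit` (Cardy's formula for ANY crossing
functional `p` of `R` already yields separating data sandwiching `p`: borrow the tree's PROVED
triangular data `smirnov_exists_separatingData_holds` and enlarge their error by
`|p δ - triDomainCrossingProb R δ| → 0`, both functionals tending to `F(η)` of one uniformizing datum,
`MarkedDomain.exists_isUniformizing_holds` + `hasCrossingLimit_triDomainCrossingProb_holds`), whence
`gsSepData_iff_gsCardy : GsSepData ↔ GsCardy` (stub 5 IS conjunct (ii), i.e. the open shared crux
`UnionJackBeffara.UnionJackMorera`, stmt-CriticalPhenomena-4558, up to the embedding bridge) and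
`voronoiSepData_iff_voronoiCardy : VoronoiSepData ↔ VoronoiCardy` (the v4 interface IS conjunct (i));
`target_iff_sepData : Target ↔ VoronoiSepData ∧ GsSepData`. Only the CANONICAL data `vorSep` of v5
(stubs 3a–3d) say more than conjunct (i): `stub_voronoiCauchy` is the typed kernel (Benjamini–Schramm
in Cauchy–Riemann form) — crux-sized, recommended for promotion to a `@[conjecture]` item.

The crux is the conjunction

* (i)  Cardy's formula for ANNEALED Poisson–Voronoi percolation (black/white nuclei two independent
  Poisson processes of Lebesgue intensity, a point is black iff it is at least as close to a black
  nucleus as to a white one, crossing = black continuum path in `closure Ω` from arc `(ab)` to arc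
  `(cd)`, nuclei rescaled by the mesh `δ`) — the Benjamini–Schramm conjecture; and
* (ii) Cardy's formula for site percolation at `1/2` on the centred square lattice
  `G_s = ℤ² ∪ (ℤ² + (½,½))` (`ℤ²` edges + centre-to-corner edges; the tetrakis / Union-Jack
  triangulation) in the crude embedded discretisation.

## Shape of the line (card `delaunay-annealed-morera`, ideator 1)

Both conjuncts are reached through Smirnov's contour argument: for every conformal rectangle with a
Carleson datum, two *Smirnov separating families* (tree structure
`Literature.Probability.Percolation.IsSmirnovFamily`) sandwich the crossing functional up to
`e(δ) → 0` at points tending to the fourth mark (`SmirnovSandwich R p`), and Smirnov families are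
obtained, as in the tree's PROVED triangular pipeline (`SmirnovSeparatingData.lean`,
`smirnov_exists_separatingFamilies_of_separatingData`), from *discrete separating data*
(`IsSeparatingData`: `[0,1]`-valued functions on finite point sets `S_δ`, dense in `closure Ω`,
approximately equicontinuous, with the discrete Cauchy estimate of Bollobás–Riordan's Lemma 13 on
lattice triangular contours and the boundary behaviour of Claim 23) by McShane interpolation
(`stub_familiesOfData`, LANDED), after which the abstract endgame (`stub_endgame`, LANDED) gives
`cardyFunction`.

## v5 (cycle 2): the Voronoi half is cut along Bollobás–Riordan's own numbering

Exactly as the tree derives the triangular (D′) from its discrete layer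
(`TriApproxDomain.isSeparatingData_of_discreteApprox`: Lemma 13 + the estimate of p. 198 +
pp. 200–201 + (40) ⇒ `IsSeparatingData` + sandwich), the CANONICAL annealed Voronoi data —
`f_δⁱ = voronoiSepProb (PB.prod PW) (forgetLast R) δ i` (Literature `VoronoiSeparating.lean`: the
probability of a black path in `closure Ω` from arc `A_{i+1}` to arc `A_{i+2}` cutting `z` from
`Aᵢ`; in this file and in the stub signatures it is UNFOLDED textually — `vorSep` below is its
definiens verbatim — because the farm had not yet built that module when v5 was registered; the
identification is `rfl`), read on the face-centre grid of the auxiliary lattice `δ𝕋` in `closure Ω`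
— are shown to be separating data sandwiching `vorCross` from five registered stubs:

* `stub_voronoiCauchy` — **the kernel** (conjecture-grade, OPEN): Lemma 13 for these data, i.e.
  the discrete Cauchy estimate `‖∮ᴰ f^{i+1} - ω ∮ᴰ fⁱ‖ ≤ n δ e(δ)` on lattice triangular contours
  in compacta of `Ω`, `ω = triangleTurn a b c` — the contour relation (36) with an
  o(1)-per-unit-length rate; by isotropy of the Poisson law the relation is expected for Voronoi
  (card: level-one 3-arm expansion, Beltrami channel killed by spin selection), NOT in print;
* `stub_voronoiEquicont` — the estimate of the proof of Claim 22 (p. 198): approximate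
  equicontinuity of `f_δⁱ` on `closure Ω` (annealed one-arm/RSW bound, Tassion 2016 Thm 1,
  Ahlberg–Griffiths–Morris–Tassion 2016, + uniform local connectivity of Jordan domains);
* `stub_voronoiBoundary` — the estimates of the proof of Claim 23 (pp. 200–201): at points of the
  open arc `Aᵢ`, `fⁱ → 0` and `f^{i+1} + f^{i+2} → 1` along face centres `z_δ → z` in `Ω`
  (RSW + colour duality of the self-matching Voronoi model);
* `stub_voronoiCorner` — (40) at `z = P₄` (p. 201, pp. 202–203): the crossing functional differs
  by `o(1)` from `f¹(z_δ)` for face centres `z_δ → d'` in `Ω` (RSW at the corner);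
* `stub_voronoiGrid` — pure lattice geometry (provable now): the Finset grid of face centres of
  `δ𝕋` in `closure Ω` exists and is eventually `ε(δ)`-dense in `closure Ω`, `ε → 0`.

The record `IsSeparatingData` and the (D′)-sandwich are assembled from these WITHOUT `sorry`
(`voronoi_isSeparatingData`, `voronoiSepData_of`). The `G_s` half keeps its single stub
`stub_gsSepData` (= the discrete input of the open shared crux `UnionJackBeffara.UnionJackMorera`,
stmt-CriticalPhenomena-4558, in this route's embedding; no exact reduction, see the evidence
`GsUnionJackDictionary.lean` of lead 0). `Target_of` composes everything and concludes
`Theses.CardyFlipRusso.Target` BY NAME; `target_iff : Target ↔ VoronoiCardy ∧ GsCardy` is `Iff.rfl`.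
Every stub SIGNATURE is written over tree constants only, so that a worker's `--supports` file can
state its stub verbatim without importing this work file.
-/

noncomputable section

namespace Summit.CriticalPhenomena.CardyFormulaZ2.Cruxes.Target.Sketch

open MeasureTheory Filter Set Metric
open scoped Topology
open Literature.Analysis.FunctionSpaces
open Literature.Probability.RandomPlanarGeometry
open Literature.Probability.RandomPlanarGeometry.MarkedDomain (forgetLast)
open Literature.Probability.LatticeModels
open Literature.Probability.Percolation
open Literature.Topology.PlaneTopology (IsJordanLoop)
open Summit.CriticalPhenomena.CardyFormulaZ2.Theses (CardyFlipRusso.VoronoiHubFromSmirnov UnionJackBeffara.UnionJackMorera)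

/-! ### §0 (v8) The ADOPTED composition `shared-cruxes-bridge` (crux-strategist s1, 2026-08-17)

`Target` is definitionally `VoronoiCardy ∧ GsCardy` (`target_iff` below).  Conjunct (i) IS the route's own crux
`CardyFlipRusso.VoronoiHubFromSmirnov` (stmt-CriticalPhenomena-6433) applied to Smirnov's theorem, which is PROVED in
the tree (`hasCrossingLimit_triDomainCrossingProb_holds`); conjunct (ii) IS the shared crux
`UnionJackBeffara.UnionJackMorera` (stmt-CriticalPhenomena-4558) through the LANDED Union-Jack endgame
(`unionJackEndgame_proof`) and ONE embedding bridge `GsCardyOfUnionJack` (Union-Jack crude Cardy ⟹ frame-A crude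
Cardy; provable now, L).  The lead adopts this composition as the REGISTERED one (its `Target_of` comes first in this
file): after the bridge lands, the crux is honestly `blocked-on: stmt-6433` (and stmt-4558) BY NAME, instead of resting
on the anonymous conjecture-grade stubs `stub_voronoiCauchy` / `stub_gsSepData` of §3.  The Smirnov pipeline of line
`Sketch` (§§1–5, v7.1: 7 stubs landed, conjunct (i) closed modulo the kernel 3a, the named-fact debt 3f and the
duality-grade 3c″) is KEPT below as the conditional Voronoi pipeline `Target_of_sketch`; its three open stubs stay
registered so that they remain landable `--supports` by name. -/

/-- **The embedding bridge** (= the split child `GsCardyOfUnionJack`, verbatim): Cardy's formula for the Union-Jack crude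
site crossings of `δG_s` (all conformal rectangles; hypothesis = the conclusion of `UnionJackBeffara.UnionJackEndgame`)
implies Cardy's formula for the frame-A crude site crossings (conjunct (ii) of `Target`). A route-posited statement of this
line (provable now, L); nothing asserted here. -/
def GsCardyOfUnionJack : Prop :=
  (let Z : Literature.Barriers.CriticalPhenomena.MixedSite → ℂ := fun v => Sum.elim (fun x : ℤ × ℤ => (((x.1 + x.2 : ℤ) : ℂ) + ((x.2 - x.1 + 1 : ℤ) : ℂ) * Complex.I) / 2) (fun f : ℤ × ℤ => (((f.1 + f.2 + 1 : ℤ) : ℂ) + ((f.2 + 1 - f.1 : ℤ) : ℂ) * Complex.I) / 2) v; let G : SimpleGraph Literature.Barriers.CriticalPhenomena.MixedSite := SimpleGraph.fromRel fun u v => ∃ x : ℤ × ℤ, u = Sum.inl x ∧ (v = Sum.inl (x.1 + 1, x.2) ∨ v = Sum.inl (x.1, x.2 + 1) ∨ ∃ f : ℤ × ℤ, v = Sum.inr f ∧ (x.1 = f.1 ∨ x.1 = f.1 + 1) ∧ (x.2 = f.2 ∨ x.2 = f.2 + 1)); let P : unitInterval → Literature.Probability.RandomPlanarGeometry.ConformalRectangle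 → ℝ → ℝ := fun q R δ => (Literature.Probability.LatticeModels.prodBernoulli (Literature.Barriers.CriticalPhenomena.mixedParam q)).real {ω | ∃ u v, Metric.infDist ((δ : ℂ) * Z u) (R.arc 0) ≤ 2 * δ ∧ Metric.infDist ((δ : ℂ) * Z v) (R.arc 2) ≤ 2 * δ ∧ ω ∈ Literature.Probability.Percolation.siteConnIn G {y | (δ : ℂ) * Z y ∈ R.carrier} u v}; ∀ R : Literature.Probability.RandomPlanarGeometry.ConformalRectangle, R.HasCrossingLimit (P Literature.Probability.Percolation.half R) Literature.Probability.RandomPlanarGeometry.cardyFunction) → (let z : (ℤ × ℤ) ⊕ (ℤ × ℤ) → ℂ := Sum.elim (fun x ↦ (x.1 : ℂ) + (x.2 : ℂ) * Complex.I) (fun f ↦ ((f.1 : ℂ) + 1 / 2) + ((f.2 : ℂ) + 1 / 2) * Complex.I); let G : SimpleGraph ((ℤ × ℤ) ⊕ (ℤ × ℤ)) := SimpleGraph.fromRel (fun a b ↦ a.isLeft = true ∧ ((b.isLeft = true ∧ dist (z a) (z b) = 1) ∨ (b.isRight = true ∧ dist (z a) (z b) < 1))); ∀ R : Literature.Probability.RandomPlanarGeometry.ConformalRectangle,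 R.HasCrossingLimit (fun δ ↦ (Literature.Probability.Percolation.sitePercolation ((ℤ × ℤ) ⊕ (ℤ × ℤ)) Literature.Probability.Percolation.half).real {ω | ∃ u v, Metric.infDist ((δ : ℂ) * z u) (R.arc 0) ≤ 2 * δ ∧ Metric.infDist ((δ : ℂ) * z v) (R.arc 2) ≤ 2 * δ ∧ ω ∈ Literature.Probability.Percolation.siteConnIn G {y | (δ : ℂ) * z y ∈ R.carrier} u v}) Literature.Probability.RandomPlanarGeometry.cardyFunction)

/-! ### The registered stubs (the ONLY `sorry`s of this file) -/

/-- STUB 1 — the route's crux **stmt-CriticalPhenomena-6433 BY NAME** (OPEN: Benjamini–Schramm; live line elsewhere; not to be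
proved inside this line). [cite: BenjaminiSchramm1998] -/
theorem stub_open_voronoiHubFromSmirnov : CardyFlipRusso.VoronoiHubFromSmirnov := by
  sorry

/-- STUB 2 — the shared crux **stmt-CriticalPhenomena-4558 BY NAME** (OPEN: Cardy–Smirnov families for site percolation on the
centred square lattice; live line on route UnionJackBeffara; not to be proved inside this line). [cite: Beffara2008Universal, §5.1] -/
theorem stub_open_unionJackMorera : UnionJackBeffara.UnionJackMorera := by
  sorry

/-- STUB 3 — **the embedding bridge** `GsCardyOfUnionJack` (= the split child, verbatim): Cardy's formula for the Union-Jack crude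
site crossings of `δG_s` (all conformal rectangles) implies Cardy's formula for the frame-A crude site crossings (conjunct (ii) of
`Target`).  Provable now (L): the collar sandwich of `CardyFlipRussoCoveringLegRobust.lean` run backwards, see the module
docstring. [cite: BollobasRiordan2006, Ch. 7 Lemma 14 and Claim 19] -/
theorem stub_gsCardyOfUnionJack :
    (let Z : Literature.Barriers.CriticalPhenomena.MixedSite → ℂ := fun v => Sum.elim (fun x : ℤ × ℤ => (((x.1 + x.2 : ℤ) : ℂ) + ((x.2 - x.1 + 1 : ℤ) : ℂ) * Complex.I) / 2) (fun f : ℤ × ℤ => (((f.1 + f.2 + 1 : ℤ) : ℂ) + ((f.2 + 1 - f.1 : ℤ) : ℂ) * Complex.I) / 2) v; let G : SimpleGraph Literature.Barriers.CriticalPhenomena.MixedSite := SimpleGraph.fromRel fun u v => ∃ x : ℤ × ℤ, u = Sum.inl x ∧ (v = Sum.inl (x.1 + 1, x.2) ∨ v = Sum.inl (x.1, x.2 + 1) ∨ ∃ f : ℤ × ℤ, v = Sum.inr f ∧ (x.1 = f.1 ∨ x.1 = f.1 + 1) ∧ (x.2 = f.2 ∨ x.2 = f.2 + 1)); let P : unitInterval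 → Literature.Probability.RandomPlanarGeometry.ConformalRectangle → ℝ → ℝ := fun q R δ => (Literature.Probability.LatticeModels.prodBernoulli (Literature.Barriers.CriticalPhenomena.mixedParam q)).real {ω | ∃ u v, Metric.infDist ((δ : ℂ) * Z u) (R.arc 0) ≤ 2 * δ ∧ Metric.infDist ((δ : ℂ) * Z v) (R.arc 2) ≤ 2 * δ ∧ ω ∈ Literature.Probability.Percolation.siteConnIn G {y | (δ : ℂ) * Z y ∈ R.carrier} u v}; ∀ R : Literature.Probability.RandomPlanarGeometry.ConformalRectangle, R.HasCrossingLimit (P Literature.Probability.Percolation.half R) Literature.Probability.RandomPlanarGeometry.cardyFunction) → (let z : (ℤ × ℤ) ⊕ (ℤ × ℤ) → ℂ := Sum.elim (fun x ↦ (x.1 : ℂ) + (x.2 : ℂ) * Complex.I) (fun f ↦ ((f.1 : ℂ) + 1 / 2) + ((f.2 : ℂ) + 1 / 2) * Complex.I); let G : SimpleGraph ((ℤ × ℤ) ⊕ (ℤ × ℤ)) := SimpleGraph.fromRel (fun a b ↦ a.isLeft = true ∧ ((b.isLeft = true ∧ dist (z a) (z b) = 1) ∨ (b.isRight = true ∧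 dist (z a) (z b) < 1))); ∀ R : Literature.Probability.RandomPlanarGeometry.ConformalRectangle, R.HasCrossingLimit (fun δ ↦ (Literature.Probability.Percolation.sitePercolation ((ℤ × ℤ) ⊕ (ℤ × ℤ)) Literature.Probability.Percolation.half).real {ω | ∃ u v, Metric.infDist ((δ : ℂ) * z u) (R.arc 0) ≤ 2 * δ ∧ Metric.infDist ((δ : ℂ) * z v) (R.arc 2) ≤ 2 * δ ∧ ω ∈ Literature.Probability.Percolation.siteConnIn G {y | (δ : ℂ) * z y ∈ R.carrier} u v}) Literature.Probability.RandomPlanarGeometry.cardyFunction) := by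
  sorry


/-- `stub_gsCardyOfUnionJack`'s statement is `GsCardyOfUnionJack`, definitionally. -/
theorem gsCardyOfUnionJack_of_stub : GsCardyOfUnionJack := stub_gsCardyOfUnionJack

/-- **`Target` from the adopted composition** (v8; the REGISTERED skeleton theorem — it comes first in this file):
conjunct (i) = stub 0a applied to Smirnov's theorem (proved), conjunct (ii) = the bridge 0c applied to the Union-Jack
endgame (landed) of stub 0b.  The only `sorry`s in its cone are `stub_open_voronoiHubFromSmirnov` (stmt-6433 BY NAME),
`stub_open_unionJackMorera` (stmt-4558 BY NAME) and `stub_gsCardyOfUnionJack` (the bridge). -/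
theorem Target_of : Theses.CardyFlipRusso.Target :=
  ⟨stub_open_voronoiHubFromSmirnov Literature.Probability.Percolation.hasCrossingLimit_triDomainCrossingProb_holds,
    stub_gsCardyOfUnionJack (Summit.CriticalPhenomena.CardyFormulaZ2.Theorems.unionJackEndgame_proof stub_open_unionJackMorera)⟩


/-! ### §1 The two crossing functionals of the crux, verbatim, in tree vocabulary -/

/-- The annealed crossing probability of the conformal rectangle `R` at mesh `δ` for Poisson–Voronoi
percolation with black/white nuclei laws `PB`, `PW` — the function of `δ` inside conjunct (i) of
`Theses.CardyFlipRusso.Target`, in tree vocabulary: the event is the Literature's `voronoiCrossing`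
(`VoronoiCrossing.lean`), which is DEFINITIONALLY the inline event (`voronoiCrossing_prod_iff`). -/
def vorCross (PB PW : Measure (PointConfig ℂ)) (R : ConformalRectangle) (δ : ℝ) : ℝ :=
  (PB.prod PW).real {c | voronoiCrossing R.carrier (R.arc 0) (R.arc 2) δ (c.1 : Set ℂ) (c.2 : Set ℂ)}

/-- The canonical annealed Voronoi separating probabilities `f_δⁱ(z)` of `R` (regarded as the
3-marked domain `forgetLast R`): Bollobás–Riordan's (9) for the black points of annealed
Poisson–Voronoi percolation, the Literature's `voronoiSepProb` under the product law (v7: folded;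
the v5/v6 inline event is its definiens, `vorSep_eq_inline`). -/
def vorSep (PB PW : Measure (PointConfig ℂ)) (R : ConformalRectangle) (δ : ℝ) (i : Fin 3) :
    ℂ → ℝ :=
  voronoiSepProb (PB.prod PW) (forgetLast R) δ i

/-- `vorSep` IS the v5/v6 inline event's probability, definitionally (so the stubs registered and
landed before the fold keep serving the same statements). -/
theorem vorSep_eq_inline (PB PW : Measure (PointConfig ℂ)) (R : ConformalRectangle) (δ : ℝ)
    (i : Fin 3) : vorSep PB PW R δ i = fun z : ℂ =>
    (PB.prod PW).real {c | ∃ x ∈ (forgetLast R).arc (i + 1), ∃ y ∈ (forgetLast R).arc (i + 2),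
      ∃ γ : Path x y, (∀ t, γ t ∈ closure (forgetLast R).carrier ∩
        {w | w / (δ : ℂ) ∈ blackRegion (c.1 : Set ℂ) (c.2 : Set ℂ)}) ∧
      (z ∉ Set.range γ ∧ ∀ p ∈ (forgetLast R).arc (i),
        ¬ JoinedIn (closure (forgetLast R).carrier \ Set.range γ) z p)} :=
  rfl

/-- The crux's METRIC description of the centred square lattice `G_s` (the `let G` of conjunct
(ii), verbatim, over the tree's `centredSquareEmbedding` = the `let z`, `rfl`): `ℤ²` edges
(left–left at distance `1`) and centre-to-corner edges (left–right at distance `< 1`, i.e. `√2/2`). -/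
def gsGraph : SimpleGraph ((ℤ × ℤ) ⊕ (ℤ × ℤ)) :=
  SimpleGraph.fromRel (fun a b ↦ a.isLeft = true ∧
    ((b.isLeft = true ∧ dist (centredSquareEmbedding a) (centredSquareEmbedding b) = 1) ∨
     (b.isRight = true ∧ dist (centredSquareEmbedding a) (centredSquareEmbedding b) < 1)))

/-- The crude crossing probability of `R` at mesh `δ` for site percolation at `1/2` on `δ G_s`:
an open path with all vertices in `Ω` whose endpoints are within `2δ` of the arcs `(ab)`, `(cd)` —
the function of `δ` inside conjunct (ii), verbatim (`siteEmbDomainCrossing` IS the inline event). -/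
def gsCross (R : ConformalRectangle) (δ : ℝ) : ℝ :=
  (sitePercolation ((ℤ × ℤ) ⊕ (ℤ × ℤ)) half).real
    (siteEmbDomainCrossing gsGraph centredSquareEmbedding R.carrier δ (R.arc 0) (R.arc 2))

/-- The same crossing probability in TREE VOCABULARY: the event is the Literature's
`centredSquareCrossing` (combinatorial `centredSquareGraph`); equal to `gsCross` by the dictionary
(`gsCross_eq_gsCrossTree`). -/
def gsCrossTree (R : ConformalRectangle) (δ : ℝ) : ℝ :=
  (sitePercolation ((ℤ × ℤ) ⊕ (ℤ × ℤ)) half).real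
    (centredSquareCrossing R.carrier δ (R.arc 0) (R.arc 2))

/-- Conjunct (i) of the crux over `vorCross`: Cardy's formula for annealed Poisson–Voronoi
percolation (the Benjamini–Schramm conjecture). -/
def VoronoiCardy : Prop :=
  ∀ (PB PW : Measure (PointConfig ℂ)),
    IsPoissonPointProcess (volume : Measure ℂ) PB → IsPoissonPointProcess (volume : Measure ℂ) PW →
    ∀ R : ConformalRectangle,
      R.HasCrossingLimit (vorCross PB PW R) Literature.Probability.RandomPlanarGeometry.cardyFunction

/-- Conjunct (ii) of the crux over `gsCross`: Cardy's formula for site percolation at `1/2` on the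
centred square lattice in the crude discretisation. -/
def GsCardy : Prop :=
  ∀ R : ConformalRectangle,
    R.HasCrossingLimit (gsCross R) Literature.Probability.RandomPlanarGeometry.cardyFunction

/-- The crux IS `VoronoiCardy ∧ GsCardy`, definitionally (the two functionals are copied verbatim,
`siteEmbDomainCrossing` / `centredSquareEmbedding` being LITERALLY the inline event / embedding). -/
theorem target_iff : Theses.CardyFlipRusso.Target ↔ VoronoiCardy ∧ GsCardy := Iff.rfl

/-! ### §2 The Smirnov sandwich of a crossing functional, and the statements -/

/-- **Smirnov sandwich** of a crossing functional `p : ℝ → ℝ` of the conformal rectangle `R`: for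
every Carleson datum `(a, b, c, d, ψ)` of `R` there are `δ₀ > 0`, two Smirnov separating families
`gm`, `gp` (`IsSmirnovFamily`), points `zm δ, zp δ ∈ Ω` tending to the fourth mark and an error
`e δ → 0` with `gm δ 1 (zm δ) - e δ ≤ p δ ≤ gp δ 1 (zp δ) + e δ` on `(0, δ₀)`. Verbatim the
conclusion of the proved triangular fact `smirnov_exists_separatingFamilies` with `p` for
`triDomainCrossingProb R`. -/
def SmirnovSandwich (R : ConformalRectangle) (p : ℝ → ℝ) : Prop :=
  ∀ (a b c d : ℂ) (ψ : ConformalEquiv R.carrier (openTriangle a b c)),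
    IsEquilateral a b c → d ∈ openSegment ℝ c a → IsCarlesonMap R a b c d ψ →
    ∃ δ₀ > (0 : ℝ), ∃ gm gp : ℝ → Fin 3 → ℂ → ℝ,
      IsSmirnovFamily R a b c δ₀ gm ∧ IsSmirnovFamily R a b c δ₀ gp ∧
      ∃ (zm zp : ℝ → ℂ) (e : ℝ → ℝ),
        (∀ δ ∈ Set.Ioo 0 δ₀, zm δ ∈ R.carrier ∧ zp δ ∈ R.carrier) ∧
        Tendsto zm (𝓝[>] 0) (𝓝 (R.pt 3)) ∧ Tendsto zp (𝓝[>] 0) (𝓝 (R.pt 3)) ∧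
        Tendsto e (𝓝[>] 0) (𝓝 0) ∧
        ∀ δ ∈ Set.Ioo 0 δ₀, gm δ 1 (zm δ) - e δ ≤ p δ ∧ p δ ≤ gp δ 1 (zp δ) + e δ

/-- The statement of `stub_endgame`: Smirnov's endgame, abstract in the crossing functional. -/
def Endgame : Prop :=
  ∀ (R : ConformalRectangle) (p : ℝ → ℝ), SmirnovSandwich R p →
    R.HasCrossingLimit p Literature.Probability.RandomPlanarGeometry.cardyFunction

/-- The annealed Poisson–Voronoi crossing functional is Smirnov-sandwiched. -/
def VoronoiMorera : Prop :=
  ∀ (PB PW : Measure (PointConfig ℂ)),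
    IsPoissonPointProcess (volume : Measure ℂ) PB → IsPoissonPointProcess (volume : Measure ℂ) PW →
    ∀ R : ConformalRectangle, SmirnovSandwich R (vorCross PB PW R)

/-- The statement of `stub_gsDictionary`: the metric description of `G_s` is `centredSquareGraph`. -/
def GsDictionary : Prop :=
  gsGraph = centredSquareGraph

/-- The crude `G_s` crossing functional over `centredSquareCrossing` is Smirnov-sandwiched. -/
def GsMorera : Prop :=
  ∀ R : ConformalRectangle, SmirnovSandwich R (gsCrossTree R)

/-- **Separating-data sandwich** of a crossing functional `p` of `R` for the triangle `abc`: two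
systems of discrete separating data (`IsSeparatingData`, root of unity `triangleTurn a b c`) whose
index-`1` functions sandwich `p` at points of their carriers tending to the fourth mark, up to
`e δ → 0`, eventually as `δ → 0⁺` — verbatim the conclusion of the tree's (D′)
`smirnov_exists_separatingData` with `p` for `triDomainCrossingProb R`. -/
def SepDataSandwich (R : ConformalRectangle) (a b c : ℂ) (p : ℝ → ℝ) : Prop :=
  ∃ (Sm Sp : ℝ → Finset ℂ) (fm fp : ℝ → Fin 3 → ℂ → ℝ),
    IsSeparatingData R (triangleTurn a b c) Sm fm ∧ IsSeparatingData R (triangleTurn a b c) Sp fp ∧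
    ∃ (zm zp : ℝ → ℂ) (e : ℝ → ℝ),
      (∀ᶠ δ in 𝓝[>] (0 : ℝ), zm δ ∈ Sm δ ∧ zm δ ∈ R.carrier ∧ zp δ ∈ Sp δ ∧ zp δ ∈ R.carrier) ∧
      Tendsto zm (𝓝[>] 0) (𝓝 (R.pt 3)) ∧ Tendsto zp (𝓝[>] 0) (𝓝 (R.pt 3)) ∧
      Tendsto e (𝓝[>] 0) (𝓝 0) ∧
      ∀ᶠ δ in 𝓝[>] (0 : ℝ), fm δ 1 (zm δ) - e δ ≤ p δ ∧ p δ ≤ fp δ 1 (zp δ) + e δ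

/-- One Carleson datum's worth of the Smirnov sandwich (the body of `SmirnovSandwich`). -/
def SmirnovSandwichAt (R : ConformalRectangle) (a b c : ℂ) (p : ℝ → ℝ) : Prop :=
  ∃ δ₀ > (0 : ℝ), ∃ gm gp : ℝ → Fin 3 → ℂ → ℝ,
    IsSmirnovFamily R a b c δ₀ gm ∧ IsSmirnovFamily R a b c δ₀ gp ∧
    ∃ (zm zp : ℝ → ℂ) (e : ℝ → ℝ),
      (∀ δ ∈ Set.Ioo 0 δ₀, zm δ ∈ R.carrier ∧ zp δ ∈ R.carrier) ∧
      Tendsto zm (𝓝[>] 0) (𝓝 (R.pt 3)) ∧ Tendsto zp (𝓝[>] 0) (𝓝 (R.pt 3)) ∧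
      Tendsto e (𝓝[>] 0) (𝓝 0) ∧
      ∀ δ ∈ Set.Ioo 0 δ₀, gm δ 1 (zm δ) - e δ ≤ p δ ∧ p δ ≤ gp δ 1 (zp δ) + e δ

/-- `SmirnovSandwich` is `SmirnovSandwichAt` for every Carleson datum. -/
theorem smirnovSandwich_iff (R : ConformalRectangle) (p : ℝ → ℝ) :
    SmirnovSandwich R p ↔ ∀ (a b c d : ℂ) (ψ : ConformalEquiv R.carrier (openTriangle a b c)),
      IsEquilateral a b c → d ∈ openSegment ℝ c a → IsCarlesonMap R a b c d ψ →
      SmirnovSandwichAt R a b c p :=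
  Iff.rfl

/-- The statement of `stub_familiesOfData`: the (D) ⇐ (D′) passage, generic in the functional. -/
def FamiliesOfData : Prop :=
  ∀ (R : ConformalRectangle) (a b c : ℂ) (p : ℝ → ℝ),
    SepDataSandwich R a b c p → SmirnovSandwichAt R a b c p

/-- Annealed Voronoi separating data (the (D′) interface for conjunct (i)). -/
def VoronoiSepData : Prop :=
  ∀ (PB PW : Measure (PointConfig ℂ)),
    IsPoissonPointProcess (volume : Measure ℂ) PB → IsPoissonPointProcess (volume : Measure ℂ) PW →
    ∀ (R : ConformalRectangle) (a b c d : ℂ) (ψ : ConformalEquiv R.carrier (openTriangle a b c)),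
      IsEquilateral a b c → d ∈ openSegment ℝ c a → IsCarlesonMap R a b c d ψ →
      SepDataSandwich R a b c (vorCross PB PW R)

/-- The statement of `stub_gsSepData`: `G_s` separating data in the tree's (D′) interface. -/
def GsSepData : Prop :=
  ∀ (R : ConformalRectangle) (a b c d : ℂ) (ψ : ConformalEquiv R.carrier (openTriangle a b c)),
    IsEquilateral a b c → d ∈ openSegment ℝ c a → IsCarlesonMap R a b c d ψ →
    SepDataSandwich R a b c (gsCrossTree R)

/-! #### The five Voronoi statements of v5 (Bollobás–Riordan's numbering, canonical data `vorSep`) -/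

/-- The statement of `stub_voronoiCauchy` — **the kernel of conjunct (i)**: Lemma 13 of
Bollobás–Riordan for the canonical annealed Voronoi separating probabilities (the `cauchy` field of
`IsSeparatingData` for the data `vorSep`, root of unity `triangleTurn a b c` of the Carleson datum). -/
def VoronoiCauchy : Prop :=
  ∀ (PB PW : Measure (PointConfig ℂ)),
    IsPoissonPointProcess (volume : Measure ℂ) PB → IsPoissonPointProcess (volume : Measure ℂ) PW →
    ∀ (R : ConformalRectangle) (a b c d : ℂ) (ψ : ConformalEquiv R.carrier (openTriangle a b c)),
      IsEquilateral a b c → d ∈ openSegment ℝ c a → IsCarlesonMap R a b c d ψ →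
      ∃ e : ℝ → ℝ, Tendsto e (𝓝[>] 0) (𝓝 0) ∧ ∀ K : Set ℂ, IsCompact K → K ⊆ R.carrier →
        ∀ᶠ δ in 𝓝[>] (0 : ℝ), ∀ (i : Fin 3) (x₀ : Site 2) (n : ℕ) (s : ℝ), (s = δ ∨ s = -δ) →
          convexHull ℝ {triMeshPoint δ x₀, triMeshPoint δ x₀ + n * s,
              triMeshPoint δ x₀ + n * s * triZeta} ⊆ K →
            ‖discreteTriangleIntegral (vorSep PB PW R δ (i + 1)) (triMeshPoint δ x₀) s n -
                triangleTurn a b c *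
                  discreteTriangleIntegral (vorSep PB PW R δ i) (triMeshPoint δ x₀) s n‖ ≤
              n * δ * e δ

/-- The statement of `stub_voronoiEquicont`'s conclusion — the estimate of the proof of Claim 22
(p. 198) for the canonical data: approximate equicontinuity of `f_δⁱ` on `closure Ω`, eventually
in `δ`. (v7: the RSW-grade inputs are the Literature named facts `VoronoiAnnealedOneArm` (F1) and
`VoronoiAnnealedBlackCircuit` (F2) of `VoronoiArmEstimates.lean`; the stub is `F1 → F2 → this`.) -/
def VoronoiEquicont : Prop :=
  ∀ (PB PW : Measure (PointConfig ℂ)),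
    IsPoissonPointProcess (volume : Measure ℂ) PB → IsPoissonPointProcess (volume : Measure ℂ) PW →
    ∀ (R : ConformalRectangle), ∀ β > (0 : ℝ), ∃ η > (0 : ℝ), ∀ᶠ δ in 𝓝[>] (0 : ℝ), ∀ (i : Fin 3),
      ∀ z ∈ closure R.carrier, ∀ z' ∈ closure R.carrier, dist z z' < η →
        vorSep PB PW R δ i z - vorSep PB PW R δ i z' ≤ β

/-- The statement of `stub_voronoiBoundaryVanish`'s conclusion (v7, ∀-sequence form of the first
half of Bollobás–Riordan's Claim-23 estimate, p. 200, "`f_δ³(z_δ) = P(E_δ³(z_δ)) = o(1)`"): for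
every point `z` of the OPEN arc `Aᵢ` and EVERY family `z_δ → z` of points of `closure Ω`,
`fⁱ(z_δ) → 0`. (A black `A_{i+1}`–`A_{i+2}` path cutting `z_δ` from `Aᵢ ∋ z` must cross the short
local join of `z_δ` to `z` in `closure Ω`, hence carries a black arm from `o(1)`-near `z` to the
fixed distance `dist(z, A_{i+1} ∪ A_{i+2}) > 0`: F1.) -/
def VoronoiBoundaryVanish : Prop :=
  ∀ (PB PW : Measure (PointConfig ℂ)),
    IsPoissonPointProcess (volume : Measure ℂ) PB → IsPoissonPointProcess (volume : Measure ℂ) PW →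
    ∀ (R : ConformalRectangle) (i : Fin 3),
      ∀ z ∈ (forgetLast R).boundary '' Ioo ((forgetLast R).mark i) ((forgetLast R).nextMark i),
        ∀ zs : ℝ → ℂ, (∀ᶠ δ : ℝ in 𝓝[>] 0, zs δ ∈ closure R.carrier) →
          Tendsto zs (𝓝[>] 0) (𝓝 z) →
          Tendsto (fun δ => vorSep PB PW R δ i (zs δ)) (𝓝[>] 0) (𝓝 0)

/-- The statement of `stub_voronoiBoundarySum` (v7, ∀-sequence form of the second half of the
Claim-23 estimate, pp. 200–201, "`f_δ¹(z_δ) + f_δ²(z_δ) = 1 - o(1)`"): for every point `z` of the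
open arc `Aᵢ` and every family `z_δ → z` of points of `Ω`, `f^{i+1}(z_δ) + f^{i+2}(z_δ) → 1`.
(Duality-grade: with `z` splitting `Aᵢ` into `L ∋ pt i` and `R' ∋ pt (i+1)`, `E^{i+1}(z_δ)` is, up
to one-arm events at `z`, a black crossing `R' ↔ A_{i+2}` and `E^{i+2}(z_δ)` a black crossing
`L ↔ A_{i+1}` of the 4-marked domain `(L, R', A_{i+1}, A_{i+2})`; exactly one of "black
`R' ↔ A_{i+2}`" / "white `L ↔ A_{i+1}`" holds (continuum colour DUALITY in a Jordan domain), and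
black/white SYMMETRY of `PB.prod PW` at equal intensities exchanges the latter with `E^{i+2}`.
This is where self-duality `p = 1/2` enters Smirnov's boundary values.) -/
def VoronoiBoundarySum : Prop :=
  ∀ (PB PW : Measure (PointConfig ℂ)),
    IsPoissonPointProcess (volume : Measure ℂ) PB → IsPoissonPointProcess (volume : Measure ℂ) PW →
    ∀ (R : ConformalRectangle) (i : Fin 3),
      ∀ z ∈ (forgetLast R).boundary '' Ioo ((forgetLast R).mark i) ((forgetLast R).nextMark i),
        ∀ zs : ℝ → ℂ, (∀ᶠ δ : ℝ in 𝓝[>] 0, zs δ ∈ R.carrier) →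
          Tendsto zs (𝓝[>] 0) (𝓝 z) →
          Tendsto (fun δ => vorSep PB PW R δ (i + 1) (zs δ) + vorSep PB PW R δ (i + 2) (zs δ))
            (𝓝[>] 0) (𝓝 1)

/-- **Continuum colour duality, EXCLUSION half, asymptotic form** (v8.2; the typed missing fact of
stub 3c″, found and type-checked by the cycle-4 worker): under the annealed Poisson–Voronoi law, a
closed-black crossing `arc 0 ↔ arc 2` and a closed-white crossing `arc 1 ↔ arc 3` of `closure Ω`
(paths in `closure Ω`, ties both colours) coexist with probability `o(1)` as `δ → 0⁺`. In print for
straight RECTANGLES and per mesh, almost surely: Bollobás–Riordan 2006, Ch. 8 Lemma 12, p. 275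
("precisely one of `H_b(R)`, `V_w(R)` holds"); for Jordan conformal rectangles with this semantics it
is not located in print (duality-grade debt, the statement of the fact stub `stub_voronoiExclusion`).
The EXISTENCE half (no closed-black `0↔2` crossing ⇒ strictly-white `1↔3` crossing) is PROVED for all
configurations (`voronoi_strictDual_of_not_crossing`, p162547) and colour symmetry is PROVED
(`IsPoissonPointProcess.measureReal_voronoiCrossing_swap`, p162054). -/
def VoronoiExclusion : Prop :=
  ∀ (PB PW : Measure (PointConfig ℂ)),
    IsPoissonPointProcess (volume : Measure ℂ) PB → IsPoissonPointProcess (volume : Measure ℂ) PW →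
    ∀ R : ConformalRectangle,
      Tendsto (fun δ : ℝ => (PB.prod PW).real
        {c | voronoiCrossing R.carrier (R.arc 0) (R.arc 2) δ (c.1 : Set ℂ) (c.2 : Set ℂ) ∧
             voronoiCrossing R.carrier (R.arc 1) (R.arc 3) δ (c.2 : Set ℂ) (c.1 : Set ℂ)})
        (𝓝[>] 0) (𝓝 0)


/-- The statement of `stub_voronoiCorner`'s conclusion (v7, ∀-sequence form of (40) at `z = P₄`,
p. 201 and pp. 202–203): along EVERY family `z_δ → d' = R.pt 3` of points of `closure Ω`, the
annealed crossing probability `vorCross` differs from `f¹(z_δ)` by `o(1)`. (Both inclusions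
between the crossing event and `E¹(z_δ)` hold off the event "a black arm from `o(1)`-near `d'` to
distance `dist(d', arc 0)/2`" (F1): a black `arc 2 → arc 0` crossing far from `d'` cuts `z_δ` from
`A₁` by the interlacing of paths in `closure Ω` (Schoenflies) and the local join of `z_δ` to `d'`;
conversely a black `A₂ → A₀` path cutting `z_δ` from `A₁` either meets `arc 2` — its final
sub-path from `arc 2` is a crossing — or misses it, and then `arc 2` followed backwards from `d'`
to `pt 2 ∈ A₁`, prefixed by the local join, contradicts the cut.) -/
def VoronoiCorner : Prop :=
  ∀ (PB PW : Measure (PointConfig ℂ)),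
    IsPoissonPointProcess (volume : Measure ℂ) PB → IsPoissonPointProcess (volume : Measure ℂ) PW →
    ∀ (R : ConformalRectangle) (zs : ℝ → ℂ), (∀ᶠ δ : ℝ in 𝓝[>] 0, zs δ ∈ closure R.carrier) →
      Tendsto zs (𝓝[>] 0) (𝓝 (R.pt 3)) →
      Tendsto (fun δ => vorCross PB PW R δ - vorSep PB PW R δ 1 (zs δ)) (𝓝[>] 0) (𝓝 0)

/-- The statement of `stub_voronoiGrid` — the face-centre grid (pure geometry): for every conformal
rectangle there is a family of finite sets `S_δ` of face centres of `δ𝕋` lying in `closure Ω`,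
containing (for `δ > 0`) every face centre of `δ𝕋` in `closure Ω`, and `ε(δ)`-dense in
`closure Ω` eventually as `δ → 0⁺`, `ε → 0`. -/
def VoronoiGrid : Prop :=
  ∀ R : ConformalRectangle, ∃ S : ℝ → Finset ℂ,
    (∀ δ, ∀ w ∈ S δ, w ∈ closure R.carrier) ∧
    (∀ δ : ℝ, 0 < δ → ∀ x : HexVertex,
      (δ : ℂ) * hexCenter x ∈ closure R.carrier → (δ : ℂ) * hexCenter x ∈ S δ) ∧
    ∃ ε : ℝ → ℝ, Tendsto ε (𝓝[>] 0) (𝓝 0) ∧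
      ∀ᶠ δ in 𝓝[>] (0 : ℝ), ∀ z ∈ closure R.carrier, ∃ w ∈ S δ, dist z w ≤ ε δ

/-! ### §3 The registered stubs (the ONLY `sorry`s of this file)

Signatures over tree constants only (`vorSep` = `voronoiSepProb (PB.prod PW) (forgetLast R)`,
`vorCross` unfolded textually; F1/F2 = the Literature named facts); `*_of_stub` (all
definitional) tie them to the §2 names. Landed stubs are imported from their `Theorems/` files. -/

/-- STUB 1 — Smirnov's endgame, abstract form (`Endgame`; LANDED p102779): a crossing functional
`p` of `R` sandwiched, for every Carleson datum, by two Smirnov separating families has crossing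
limit `cardyFunction`. -/
theorem stub_endgame : ∀ (R : ConformalRectangle) (p : ℝ → ℝ),
    (∀ (a b c d : ℂ) (ψ : ConformalEquiv R.carrier (openTriangle a b c)),
      IsEquilateral a b c → d ∈ openSegment ℝ c a → IsCarlesonMap R a b c d ψ →
      ∃ δ₀ > (0 : ℝ), ∃ gm gp : ℝ → Fin 3 → ℂ → ℝ,
        IsSmirnovFamily R a b c δ₀ gm ∧ IsSmirnovFamily R a b c δ₀ gp ∧
        ∃ (zm zp : ℝ → ℂ) (e : ℝ → ℝ),
          (∀ δ ∈ Set.Ioo 0 δ₀, zm δ ∈ R.carrier ∧ zp δ ∈ R.carrier) ∧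
          Tendsto zm (𝓝[>] 0) (𝓝 (R.pt 3)) ∧ Tendsto zp (𝓝[>] 0) (𝓝 (R.pt 3)) ∧
          Tendsto e (𝓝[>] 0) (𝓝 0) ∧
          ∀ δ ∈ Set.Ioo 0 δ₀, gm δ 1 (zm δ) - e δ ≤ p δ ∧ p δ ≤ gp δ 1 (zp δ) + e δ) →
    R.HasCrossingLimit p Literature.Probability.RandomPlanarGeometry.cardyFunction :=
  -- LANDED (p102779): `Theorems/CardyFlipRussoTargetStubEndgame.lean`
  Theorems.CardyFlipRussoTarget.stub_endgame

/-- STUB 2 — Smirnov families from separating data, generic in the functional (`FamiliesOfData`;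
LANDED p106871 as `Theorems/CardyFlipRussoTargetStubFamiliesOfData.lean`; its proof is repeated here
verbatim instead of imported only because the farm had not yet built that module when v5 was
registered — no longer a stub). -/
theorem stub_familiesOfData : ∀ (R : ConformalRectangle) (a b c : ℂ) (p : ℝ → ℝ),
    (∃ (Sm Sp : ℝ → Finset ℂ) (fm fp : ℝ → Fin 3 → ℂ → ℝ),
      IsSeparatingData R (triangleTurn a b c) Sm fm ∧ IsSeparatingData R (triangleTurn a b c) Sp fp ∧
      ∃ (zm zp : ℝ → ℂ) (e : ℝ → ℝ),
        (∀ᶠ δ in 𝓝[>] (0 : ℝ), zm δ ∈ Sm δ ∧ zm δ ∈ R.carrier ∧ zp δ ∈ Sp δ ∧ zp δ ∈ R.carrier) ∧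
        Tendsto zm (𝓝[>] 0) (𝓝 (R.pt 3)) ∧ Tendsto zp (𝓝[>] 0) (𝓝 (R.pt 3)) ∧
        Tendsto e (𝓝[>] 0) (𝓝 0) ∧
        ∀ᶠ δ in 𝓝[>] (0 : ℝ), fm δ 1 (zm δ) - e δ ≤ p δ ∧ p δ ≤ fp δ 1 (zp δ) + e δ) →
    ∃ δ₀ > (0 : ℝ), ∃ gm gp : ℝ → Fin 3 → ℂ → ℝ,
      IsSmirnovFamily R a b c δ₀ gm ∧ IsSmirnovFamily R a b c δ₀ gp ∧
      ∃ (zm zp : ℝ → ℂ) (e : ℝ → ℝ),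
        (∀ δ ∈ Set.Ioo 0 δ₀, zm δ ∈ R.carrier ∧ zp δ ∈ R.carrier) ∧
        Tendsto zm (𝓝[>] 0) (𝓝 (R.pt 3)) ∧ Tendsto zp (𝓝[>] 0) (𝓝 (R.pt 3)) ∧
        Tendsto e (𝓝[>] 0) (𝓝 0) ∧
        ∀ δ ∈ Set.Ioo 0 δ₀, gm δ 1 (zm δ) - e δ ≤ p δ ∧ p δ ≤ gp δ 1 (zp δ) + e δ :=
  -- LANDED (p106871): `Theorems/CardyFlipRussoTargetStubFamiliesOfData.lean` (v7: imported)
  Theorems.CardyFlipRussoTarget.stub_familiesOfData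


/-- STUB 3a — **the kernel** (`VoronoiCauchy`; OPEN, conjecture-grade): Bollobás–Riordan's
Lemma 13 — the discrete Cauchy estimate, i.e. the contour relation (36) with an
o(1)-per-unit-length rate — for the annealed separating probabilities
`voronoiSepProb (PB.prod PW) (forgetLast R)` of Poisson–Voronoi percolation, read at the face
centres of `δ𝕋`, on lattice triangular contours in compacta of `Ω`, with the root of unity
`triangleTurn a b c` of the Carleson datum. (v7: folded over `voronoiSepProb`; the v5/v6 signature
is this one with `voronoiSepProb` unfolded, `vorSep_eq_inline`.) This is the typed kernel of the
Benjamini–Schramm conjecture in this tree's vocabulary: given the approximate equicontinuity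
(stub 3b) it is EQUIVALENT to "every subsequential uniform limit of `(f_δ⁰, f_δ¹, f_δ²)` satisfies
the contour relation (36)", hence (with the boundary values) to Cardy–Smirnov for annealed Voronoi;
no proof is known in print (Bollobás–Riordan 2006, Ch. 8, p. 286; Tassion 2016, §1). -/
theorem stub_voronoiCauchy : ∀ (PB PW : Measure (PointConfig ℂ)),
    IsPoissonPointProcess (volume : Measure ℂ) PB → IsPoissonPointProcess (volume : Measure ℂ) PW →
    ∀ (R : ConformalRectangle) (a b c d : ℂ) (ψ : ConformalEquiv R.carrier (openTriangle a b c)),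
      IsEquilateral a b c → d ∈ openSegment ℝ c a → IsCarlesonMap R a b c d ψ →
      ∃ e : ℝ → ℝ, Tendsto e (𝓝[>] 0) (𝓝 0) ∧ ∀ K : Set ℂ, IsCompact K → K ⊆ R.carrier →
        ∀ᶠ δ in 𝓝[>] (0 : ℝ), ∀ (i : Fin 3) (x₀ : Site 2) (n : ℕ) (s : ℝ), (s = δ ∨ s = -δ) →
          convexHull ℝ {triMeshPoint δ x₀, triMeshPoint δ x₀ + n * s,
              triMeshPoint δ x₀ + n * s * triZeta} ⊆ K →
            ‖discreteTriangleIntegral (voronoiSepProb (PB.prod PW) (forgetLast R) δ (i + 1))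
                  (triMeshPoint δ x₀) s n -
                triangleTurn a b c *
                  discreteTriangleIntegral (voronoiSepProb (PB.prod PW) (forgetLast R) δ i)
                    (triMeshPoint δ x₀) s n‖ ≤
              n * δ * e δ := by
  sorry

/-- STUB 3b — approximate equicontinuity FROM TASSION'S TWO ESTIMATES (`F1 → F2 → VoronoiEquicont`;
the cycle-3 worker proved exactly this implication in the v6 inline form, 1112 lines, rc 0,
standard axioms — the file was not landed and is lost, so it is re-proved against the folded
names): the estimate of Bollobás–Riordan's proof of Claim 22, p. 198, for the annealed Voronoi
separating probabilities — for `β > 0` there is `η > 0` such that, eventually as `δ → 0⁺`,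
`f_δⁱ(z) - f_δⁱ(w) ≤ β` for all `z, w ∈ closure Ω` with `dist z w < η`. Proof idea: on
`E(z) ∖ E(w)` the separating path passes within `ε'` of `z` (uniform local path-connectedness of
`closure Ω`, `exists_joinedIn_closure_ball`), so either a black arm crosses `A(z; ε', ρ)` (F1) or
`z`, `w` are `ρ`-close to the corner `pt (i+2) = A_{i+1} ∩ A_{i+2}`, where a black circuit around
the corner in `A(pt(i+2); r, ρ')` (F2, absent only with small probability) contains a black
`A_{i+1}`–`A_{i+2}` sub-arc in `closure Ω` cutting `w` from `Aᵢ`, i.e. forces `E(w)` (Jordan loop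
around a boundary point leaves `closure Ω`: `exists_param_not_mem_closure`; trimming:
`exists_trimmed_interval`; cut: Newman's cross-cut theorem `Newman1939_crosscut_holds` /
`inter_nonempty_of_crosscut`, Janiszewski); no colour duality is needed. -/
theorem stub_voronoiEquicont : VoronoiAnnealedOneArm → VoronoiAnnealedBlackCircuit →
    ∀ (PB PW : Measure (PointConfig ℂ)),
    IsPoissonPointProcess (volume : Measure ℂ) PB → IsPoissonPointProcess (volume : Measure ℂ) PW →
    ∀ (R : ConformalRectangle), ∀ β > (0 : ℝ), ∃ η > (0 : ℝ), ∀ᶠ δ : ℝ in 𝓝[>] 0, ∀ (i : Fin 3),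
      ∀ z ∈ closure R.carrier, ∀ z' ∈ closure R.carrier, dist z z' < η →
        voronoiSepProb (PB.prod PW) (forgetLast R) δ i z -
          voronoiSepProb (PB.prod PW) (forgetLast R) δ i z' ≤ β :=
  -- LANDED (p157418): `Theorems/CardyFlipRussoTargetStubVoronoiEquicont.lean`
  Theorems.CardyFlipRussoTarget.stub_voronoiEquicont

/-- STUB 3f — **the RSW-grade debts** (`VoronoiAnnealedOneArm ∧ VoronoiAnnealedBlackCircuit`; v7:
literally the two Literature NAMED FACTS of `VoronoiArmEstimates.lean`, p114934): Tassion's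
annealed one-arm bound (Thm 3 (2)) and black-circuit bound (proof of Thm 3 (2), §4) for critical
Poisson–Voronoi percolation, mesh-uniform. Published theorems not yet proved in the tree: closing
this stub = discharging the two named facts (`…_holds`), i.e. formalising Tassion 2016 (RSW Thm 1
by renormalisation, FKG and quasi-independence for Voronoi = Bollobás–Riordan Ch. 8 Lemmas 14,
18) — XL, the line's typed "What is missing"; until then the line is CONDITIONAL on F1, F2. -/
theorem stub_tassionEstimates : VoronoiAnnealedOneArm ∧ VoronoiAnnealedBlackCircuit := by
  sorry

/-- STUB 3c′ — boundary vanishing (`F1 → VoronoiBoundaryVanish`; v7 reshape of the first half of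
`stub_voronoiBoundary`, ∀-sequence form; Bollobás–Riordan, proof of Claim 23, p. 200): for every
point `z` of the open arc `Aᵢ` of `(Ω; a', b', c')` and every family `z_δ → z` in `closure Ω`,
`f_δⁱ(z_δ) → 0`. Proof: `z ∉ A_{i+1} ∪ A_{i+2}` (injectivity of the boundary loop on a period),
so `ρ₀ := dist(z, A_{i+1} ∪ A_{i+2})/2 > 0`; given `β`, F1 (`VoronoiAnnealedOneArm.exists_radius`)
gives `ε ∈ (0, ρ₀)` with arm probability `≤ β` for small `δ`; `exists_joinedIn_closure_ball` gives
`η` such that `z_δ` (eventually `η`-close to `z`) is joined to `z` inside `closure Ω ∩ B(z_δ, ε)`;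
on `Eⁱ(z_δ)` that join meets the separating path `γ` (else `z_δ` is joined to `z ∈ Aᵢ` off `γ`),
whose start on `A_{i+1}` is `≥ ρ₀` away: the reversed sub-path of `γ` (`exists_subpath`) is a black
arm from `B̄(z_δ, ε)` to `{dist · z_δ ≥ ρ₀}`; `measureReal_mono`. -/
theorem stub_voronoiBoundaryVanish : VoronoiAnnealedOneArm →
    ∀ (PB PW : Measure (PointConfig ℂ)),
    IsPoissonPointProcess (volume : Measure ℂ) PB → IsPoissonPointProcess (volume : Measure ℂ) PW →
    ∀ (R : ConformalRectangle) (i : Fin 3),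
      ∀ z ∈ (forgetLast R).boundary '' Ioo ((forgetLast R).mark i) ((forgetLast R).nextMark i),
        ∀ zs : ℝ → ℂ, (∀ᶠ δ : ℝ in 𝓝[>] 0, zs δ ∈ closure R.carrier) →
          Tendsto zs (𝓝[>] 0) (𝓝 z) →
          Tendsto (fun δ => voronoiSepProb (PB.prod PW) (forgetLast R) δ i (zs δ))
            (𝓝[>] 0) (𝓝 0) :=
  -- LANDED (p157808): `Theorems/CardyFlipRussoTargetStubVoronoiBoundaryVanish.lean`
  Theorems.CardyFlipRussoTarget.stub_voronoiBoundaryVanish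

/-- STUB 3c″ — boundary sum (`F1 → VoronoiBoundarySum`; v7/v8.1 reshape of the second half of
`stub_voronoiBoundary`, ∀-sequence form; Bollobás–Riordan, proof of Claim 23, pp. 200–201,
"`f_δ¹(z_δ) + f_δ²(z_δ) = 1 - o(1)`"; DUALITY-grade): for every point `z` of the open arc `Aᵢ`
and every family `z_δ → z` in `Ω`, `f_δ^{i+1}(z_δ) + f_δ^{i+2}(z_δ) → 1`. Needs, besides F1 and
the local join: continuum colour duality for black/white crossings of the 4-marked Jordan domain
`(L, R', A_{i+1}, A_{i+2})` (`z` splitting `Aᵢ` into `L`, `R'`) and the black/white symmetry of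
`PB.prod PW` (equal intensities; ties have probability-zero effect) — neither is a tree fact yet. -/
theorem stub_voronoiBoundarySum : VoronoiAnnealedOneArm →
    (∀ (PB PW : Measure (PointConfig ℂ)),
      IsPoissonPointProcess (volume : Measure ℂ) PB → IsPoissonPointProcess (volume : Measure ℂ) PW →
      ∀ R : ConformalRectangle,
        Tendsto (fun δ : ℝ => (PB.prod PW).real
          {c | voronoiCrossing R.carrier (R.arc 0) (R.arc 2) δ (c.1 : Set ℂ) (c.2 : Set ℂ) ∧
               voronoiCrossing R.carrier (R.arc 1) (R.arc 3) δ (c.2 : Set ℂ) (c.1 : Set ℂ)})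
          (𝓝[>] 0) (𝓝 0)) →
    ∀ (PB PW : Measure (PointConfig ℂ)),
    IsPoissonPointProcess (volume : Measure ℂ) PB → IsPoissonPointProcess (volume : Measure ℂ) PW →
    ∀ (R : ConformalRectangle) (i : Fin 3),
      ∀ z ∈ (forgetLast R).boundary '' Ioo ((forgetLast R).mark i) ((forgetLast R).nextMark i),
        ∀ zs : ℝ → ℂ, (∀ᶠ δ : ℝ in 𝓝[>] 0, zs δ ∈ R.carrier) →
          Tendsto zs (𝓝[>] 0) (𝓝 z) →
          Tendsto (fun δ => voronoiSepProb (PB.prod PW) (forgetLast R) δ (i + 1) (zs δ) +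
              voronoiSepProb (PB.prod PW) (forgetLast R) δ (i + 2) (zs δ)) (𝓝[>] 0) (𝓝 1) :=
  -- LANDED (p165235): `Theorems/CardyFlipRussoTargetStubVoronoiBoundarySum.lean`
  Theorems.CardyFlipRussoTarget.stub_voronoiBoundarySum

/-- STUB 3c‴ — **the duality-grade debt** (`VoronoiExclusion`, v8.2): the exclusion half of continuum
colour duality for annealed Poisson–Voronoi crossings of a conformal rectangle, asymptotic form (typed
by the cycle-4 worker of 3c″; Bollobás–Riordan 2006 Ch. 8 Lemma 12 p. 275 proves the per-mesh a.s.
form for straight rectangles by the exterior-colouring / trivalent-interface argument; the transfer to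
Jordan domains with paths in `closure Ω` needs an a.s. classification of colour pinches at a wild
boundary — not in the tree, not located in print). Given it and F1, 3c″ is routine (worker dossier). -/
theorem stub_voronoiExclusion :
    ∀ (PB PW : Measure (PointConfig ℂ)),
      IsPoissonPointProcess (volume : Measure ℂ) PB → IsPoissonPointProcess (volume : Measure ℂ) PW →
      ∀ R : ConformalRectangle,
        Tendsto (fun δ : ℝ => (PB.prod PW).real
          {c | voronoiCrossing R.carrier (R.arc 0) (R.arc 2) δ (c.1 : Set ℂ) (c.2 : Set ℂ) ∧
               voronoiCrossing R.carrier (R.arc 1) (R.arc 3) δ (c.2 : Set ℂ) (c.1 : Set ℂ)})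
          (𝓝[>] 0) (𝓝 0) := by
  sorry

/-- STUB 3d — the corner identification (`F1 → VoronoiCorner`; v7 ∀-sequence form of
Bollobás–Riordan's (40) at `z = P₄`, p. 201 and pp. 202–203, for the annealed Voronoi model): along
every family `z_δ → d' = R.pt 3` in `closure Ω`, the annealed crossing probability of `R` (black
continuum path in `closure Ω` from `(ab)` to `(cd)`) differs from `f_δ¹(z_δ)` by `o(1)`. Proof:
`ρ₀ := dist(d', arc 0)/2 > 0`; off the F1-small event "a black arm from `B̄(d', ε)` to
`{dist · d' ≥ ρ₀}`" and once `z_δ` is joined to `d'` inside `closure Ω ∩ B(d', ε)`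
(`exists_joinedIn_closure_ball`): (⊆) a black `arc 0 ↔ arc 2` crossing `γ` avoiding `B(d', ε)`
cuts `z_δ` from `A₁ = arc 1` — a path from `z_δ` to `arc 1` off `γ`, prefixed by the join, would be
a path `d' ↝ arc 1` in `closure Ω` missing `γ : arc 2 ↝ arc 0`, against the interlacing of paths in
`closure Ω` with interleaved boundary ends (Schoenflies `exists_schoenflies` + crossing paths in a
disc/square); (⊇) a black `A₂ → A₀` path `γ` cutting `z_δ` from `A₁` either meets `arc 2` (its
sub-path after the LAST visit is a crossing, `exists_subpath`) or misses it, and then `arc 2`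
traversed from `d'` back to `pt 2 ∈ A₁`, prefixed by the join, joins `z_δ` to `A₁` off `γ` —
contradiction; so the two events differ by at most the arm event, `|P - P'| ≤ β`. -/
theorem stub_voronoiCorner : VoronoiAnnealedOneArm →
    ∀ (PB PW : Measure (PointConfig ℂ)),
    IsPoissonPointProcess (volume : Measure ℂ) PB → IsPoissonPointProcess (volume : Measure ℂ) PW →
    ∀ (R : ConformalRectangle) (zs : ℝ → ℂ), (∀ᶠ δ : ℝ in 𝓝[>] 0, zs δ ∈ closure R.carrier) →
      Tendsto zs (𝓝[>] 0) (𝓝 (R.pt 3)) →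
      Tendsto (fun δ : ℝ => (PB.prod PW).real
            {c | voronoiCrossing R.carrier (R.arc 0) (R.arc 2) δ (c.1 : Set ℂ) (c.2 : Set ℂ)} -
          voronoiSepProb (PB.prod PW) (forgetLast R) δ 1 (zs δ)) (𝓝[>] 0) (𝓝 0) :=
  -- LANDED (p158262): `Theorems/CardyFlipRussoTargetStubVoronoiCorner.lean`
  Theorems.CardyFlipRussoTarget.stub_voronoiCorner

/-- **The infimum trick.** If a property of `(δ, η)` holds, for every `η > 0`, at all small
`δ > 0`, then there is a choice `ε δ → 0⁺` with the property at `(δ, ε δ)` for all small `δ`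
(proof copied from `CardySusyWardDiscretisationFamilyExists.exists_tendsto_of_forall_eventually`;
these private helpers are repeated from the LANDED `Theorems/CardyFlipRussoTargetStubVoronoiGrid.lean`,
p109546, where they are private; here they serve the glue lemma `exists_hexCenter_seq_tendsto`).
[folklore] -/
private theorem exists_tendsto_of_forall_eventually {P : ℝ → ℝ → Prop}
    (h : ∀ η : ℝ, 0 < η → ∀ᶠ δ in 𝓝[>] (0 : ℝ), P δ η) :
    ∃ ε : ℝ → ℝ, Tendsto ε (𝓝[>] 0) (𝓝 0) ∧ ∀ᶠ δ in 𝓝[>] (0 : ℝ), 0 < ε δ ∧ P δ (ε δ) := by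
  classical
  set G : ℝ → Set ℝ := fun δ => {η | 0 < η ∧ P δ η} with hG
  have hbdd : ∀ δ, BddBelow (G δ) := fun δ => ⟨0, fun η hη => hη.1.le⟩
  set ε : ℝ → ℝ := fun δ =>
    if hx : ∃ η, η ∈ G δ ∧ η < sInf (G δ) + δ then Classical.choose hx else 1 with hε
  have hmem : ∀ η : ℝ, 0 < η → ∀ᶠ δ in 𝓝[>] (0 : ℝ), η ∈ G δ := fun η hη =>
    (h η hη).mono fun δ hδ => ⟨hη, hδ⟩
  have hpos : ∀ᶠ δ in 𝓝[>] (0 : ℝ), 0 < δ := self_mem_nhdsWithin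
  -- the choice is made, eventually
  have hchoice : ∀ᶠ δ in 𝓝[>] (0 : ℝ), ε δ ∈ G δ ∧ ε δ < sInf (G δ) + δ := by
    filter_upwards [hmem 1 one_pos, hpos] with δ h1 hδ
    have hx : ∃ η, η ∈ G δ ∧ η < sInf (G δ) + δ := by
      obtain ⟨η, hη, hlt⟩ := exists_lt_of_csInf_lt ⟨1, h1⟩ (lt_add_of_pos_right _ hδ)
      exact ⟨η, hη, hlt⟩
    have : ε δ = Classical.choose hx := by rw [hε]; exact dif_pos hx
    rw [this]
    exact Classical.choose_spec hx
  refine ⟨ε, ?_, hchoice.mono fun δ hδ => ⟨hδ.1.1, hδ.1.2⟩⟩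
  rw [Metric.tendsto_nhds]
  intro e he
  filter_upwards [hchoice, hmem (e / 2) (by positivity),
    Ioo_mem_nhdsGT (show (0 : ℝ) < e / 2 by positivity)] with δ hc h2 hδ
  have hinf : sInf (G δ) ≤ e / 2 := csInf_le (hbdd δ) h2
  rw [Real.dist_eq, sub_zero, abs_of_pos hc.1.1]
  linarith [hc.2, hδ.2]

/-- **The face centres of `δ𝕋` are `3δ`-dense in the plane** (`δ > 0`): every point is within `2δ`
of a site (`exists_site_dist_le`) and a site is within `δ` of the centre of its up face
(`dist_triMeshPoint_hexCenter_le`). [folklore] -/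
private theorem exists_hexCenter_dist_le (y : ℂ) {δ : ℝ} (hδ : 0 < δ) :
    ∃ F : HexVertex, dist ((δ : ℂ) * hexCenter F) y ≤ 3 * δ := by
  obtain ⟨x, hx⟩ := exists_site_dist_le y hδ
  refine ⟨(x, 0), ?_⟩
  have hv : x ∈ hexFaceVertices (x, 0) := mem_hexFaceVertices_zero.2 (Or.inl rfl)
  have h1 := dist_triMeshPoint_hexCenter_le hv δ
  rw [abs_of_pos hδ, dist_comm] at h1
  calc dist ((δ : ℂ) * hexCenter (x, 0)) y
      ≤ dist ((δ : ℂ) * hexCenter (x, 0)) (triMeshPoint δ x) + dist (triMeshPoint δ x) y :=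
        dist_triangle _ _ _
    _ ≤ δ + 2 * δ := add_le_add h1 hx
    _ = 3 * δ := by ring

/-- **Face centres in `Ω` are eventually `η`-dense in `closure Ω`**: for every `η > 0`, for all
small `δ > 0`, every `z ∈ closure Ω` is within `η` of a face centre of `δ𝕋` lying in `Ω` (finite
cover of the compact `closure Ω` by balls `B(y, η/2)`, `y ∈ Ω`, a uniform radius `r` with
`B̄(y, r) ⊆ Ω`, and `3δ`-density of the face centres). [folklore] -/
private theorem eventually_forall_exists_hexCenter (R : ConformalRectangle) {η : ℝ} (hη : 0 < η) :
    ∀ᶠ δ : ℝ in 𝓝[>] (0 : ℝ), ∀ z ∈ closure R.carrier, ∃ F : HexVertex,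
      (δ : ℂ) * hexCenter F ∈ R.carrier ∧ dist z ((δ : ℂ) * hexCenter F) ≤ η := by
  have hK : IsCompact (closure R.carrier) := R.isBounded.isCompact_closure
  -- cover `closure Ω` by balls of radius `η/2` centred in `Ω`
  have hcover : closure R.carrier ⊆ ⋃ y : R.carrier, ball (y : ℂ) (η / 2) := by
    intro z hz
    obtain ⟨y, hy, hzy⟩ := Metric.mem_closure_iff.1 hz (η / 2) (by positivity)
    exact mem_iUnion.2 ⟨⟨y, hy⟩, mem_ball.2 hzy⟩
  obtain ⟨T, hT⟩ :=
    hK.elim_finite_subcover (fun y : R.carrier => ball (y : ℂ) (η / 2)) (fun _ => isOpen_ball) hcover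
  -- a uniform radius `r` with `closedBall y r ⊆ Ω` for the finitely many centres `y ∈ T`
  set T' : Set ℂ := ((↑) : R.carrier → ℂ) '' (T : Set R.carrier) with hT'
  have hT'fin : T'.Finite := T.finite_toSet.image _
  have hT'sub : T' ⊆ R.carrier := by
    rintro _ ⟨y, _, rfl⟩
    exact y.2
  obtain ⟨r, hr, hrΩ⟩ := hT'fin.isCompact.exists_cthickening_subset_open R.isOpen hT'sub
  have hm : 0 < min r (η / 2) / 3 := by positivity
  filter_upwards [Ioc_mem_nhdsGT hm] with δ hδ
  intro z hz
  obtain ⟨y, hyT, hzy⟩ : ∃ y : R.carrier, y ∈ T ∧ dist z (y : ℂ) < η / 2 := by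
    have h := hT hz
    simp only [mem_iUnion, mem_ball, exists_prop] at h
    exact h
  obtain ⟨F, hF⟩ := exists_hexCenter_dist_le (y : ℂ) hδ.1
  have h3 : 3 * δ ≤ min r (η / 2) := by linarith [hδ.2]
  refine ⟨F, ?_, ?_⟩
  · refine hrΩ (closedBall_subset_cthickening (show (y : ℂ) ∈ T' from ⟨y, hyT, rfl⟩) r ?_)
    rw [mem_closedBall]
    exact hF.trans (h3.trans (min_le_left _ _))
  · calc dist z ((δ : ℂ) * hexCenter F)
        ≤ dist z y + dist ((δ : ℂ) * hexCenter F) y := dist_triangle_right _ _ _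
      _ ≤ η / 2 + η / 2 := add_le_add hzy.le (hF.trans (h3.trans (min_le_right _ _)))
      _ = η := by ring

/-- STUB 3e — the face-centre grid (`VoronoiGrid`; pure lattice geometry; LANDED p109546): for every
conformal rectangle there are finite sets `S_δ ⊆ closure Ω` of face centres of `δ𝕋` containing,
for `δ > 0`, every face centre of `δ𝕋` lying in `closure Ω`, and eventually `ε(δ)`-dense in
`closure Ω` with `ε(δ) → 0` (compactness of `closure Ω` and density of the face centres of `δ𝕋`
at scale `δ`). -/
theorem stub_voronoiGrid : ∀ R : ConformalRectangle, ∃ S : ℝ → Finset ℂ,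
    (∀ δ, ∀ w ∈ S δ, w ∈ closure R.carrier) ∧
    (∀ δ : ℝ, 0 < δ → ∀ x : HexVertex,
      (δ : ℂ) * hexCenter x ∈ closure R.carrier → (δ : ℂ) * hexCenter x ∈ S δ) ∧
    ∃ ε : ℝ → ℝ, Tendsto ε (𝓝[>] 0) (𝓝 0) ∧
      ∀ᶠ δ in 𝓝[>] (0 : ℝ), ∀ z ∈ closure R.carrier, ∃ w ∈ S δ, dist z w ≤ ε δ :=
  -- LANDED (p109546): `Theorems/CardyFlipRussoTargetStubVoronoiGrid.lean` (v7: imported)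
  Theorems.CardyFlipRussoTarget.stub_voronoiGrid

/-- **Face centres in `Ω` tending to a prescribed point of `closure Ω`** (pure lattice geometry, the
glue's choice of sequences for the ∀-sequence stubs 3c′, 3c″, 3d): for every `w ∈ closure Ω` there
is a family of faces `F_δ` of `𝕋` with `δ · hexCenter F_δ ∈ Ω` for all small `δ > 0` and
`δ · hexCenter F_δ → w` as `δ → 0⁺` (the infimum trick applied to the eventual `η`-density of the
face centres lying in `Ω`). [folklore] -/
theorem exists_hexCenter_seq_tendsto (R : ConformalRectangle) {w : ℂ} (hw : w ∈ closure R.carrier) :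
    ∃ zs : ℝ → HexVertex, (∀ᶠ δ : ℝ in 𝓝[>] 0, (δ : ℂ) * hexCenter (zs δ) ∈ R.carrier) ∧
      Tendsto (fun δ : ℝ => (δ : ℂ) * hexCenter (zs δ)) (𝓝[>] 0) (𝓝 w) := by
  classical
  obtain ⟨ε, hε, hev⟩ := exists_tendsto_of_forall_eventually
    (P := fun δ η => ∃ F : HexVertex, (δ : ℂ) * hexCenter F ∈ R.carrier ∧
      dist w ((δ : ℂ) * hexCenter F) ≤ η) fun η hη =>
      (eventually_forall_exists_hexCenter R hη).mono fun δ hδ => hδ w hw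
  refine ⟨fun δ => if h : ∃ F : HexVertex, (δ : ℂ) * hexCenter F ∈ R.carrier ∧
      dist w ((δ : ℂ) * hexCenter F) ≤ ε δ then Classical.choose h else ((0 : Site 2), (0 : Fin 2)),
    ?_, ?_⟩
  · filter_upwards [hev] with δ hδ
    rw [dif_pos hδ.2]
    exact (Classical.choose_spec hδ.2).1
  · rw [tendsto_iff_dist_tendsto_zero]
    refine squeeze_zero_norm' ?_ hε
    filter_upwards [hev] with δ hδ
    rw [dif_pos hδ.2, Real.norm_eq_abs, abs_of_nonneg dist_nonneg, dist_comm]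
    exact (Classical.choose_spec hδ.2).2


/-- STUB 4 — the `G_s` dictionary (`GsDictionary`; LANDED p104088): the crux's metric description
of the centred square lattice generates the tree's combinatorial `centredSquareGraph`. -/
theorem stub_gsDictionary :
    (SimpleGraph.fromRel (fun a b : (ℤ × ℤ) ⊕ (ℤ × ℤ) ↦ a.isLeft = true ∧
      ((b.isLeft = true ∧ dist (centredSquareEmbedding a) (centredSquareEmbedding b) = 1) ∨
       (b.isRight = true ∧ dist (centredSquareEmbedding a) (centredSquareEmbedding b) < 1)))) =
    centredSquareGraph :=
  -- LANDED (p104088): `Theorems/CardyFlipRussoTargetStubGsDictionary.lean`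
  Theorems.CardyFlipRussoTarget.stub_gsDictionary

/- (v8) The v5–v7 STUB 5 `stub_gsSepData : GsSepData` (anonymous, ⟺ conjunct (ii) by `gsSepData_iff_gsCardy`,
§5) is RETIRED: conjunct (ii) now enters both compositions through the shared crux stmt-4558 BY NAME and the
embedding bridge of §0. -/

/-- `stub_familiesOfData`'s statement is `FamiliesOfData` (§2), definitionally. -/
theorem familiesOfData_of_stub : FamiliesOfData := stub_familiesOfData

/-- `stub_voronoiCauchy`'s statement is `VoronoiCauchy` (§2), definitionally. -/
theorem voronoiCauchy_of_stub : VoronoiCauchy := stub_voronoiCauchy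

/-- `VoronoiEquicont` (§2) from the implication stub 3b and the fact stub 3f. -/
theorem voronoiEquicont_of_stub : VoronoiEquicont :=
  stub_voronoiEquicont stub_tassionEstimates.1 stub_tassionEstimates.2

/-- `VoronoiBoundaryVanish` (§2) from the implication stub 3c′ and F1 (fact stub 3f). -/
theorem voronoiBoundaryVanish_of_stub : VoronoiBoundaryVanish :=
  stub_voronoiBoundaryVanish stub_tassionEstimates.1

/-- `VoronoiBoundarySum` (§2) from the implication stub 3c″ and F1 (fact stub 3f) (v8.1/v8.2 reshape: the `z_δ`-vs-`z`
discrepancy of the duality picture is a one-arm event at `z`, so F1 is a hypothesis of the stub, as for 3c′/3d; the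
exclusion half of colour duality is the second hypothesis, discharged by the fact stub 3c‴). -/
theorem voronoiBoundarySum_of_stub : VoronoiBoundarySum :=
  stub_voronoiBoundarySum stub_tassionEstimates.1 stub_voronoiExclusion

/-- The fact stub 3c‴ IS `VoronoiExclusion` (§2), definitionally. -/
theorem voronoiExclusion_of_stub : VoronoiExclusion := stub_voronoiExclusion

/-- `VoronoiCorner` (§2) from the implication stub 3d and F1 (fact stub 3f). -/
theorem voronoiCorner_of_stub : VoronoiCorner :=
  stub_voronoiCorner stub_tassionEstimates.1

/-- `stub_voronoiGrid`'s statement is `VoronoiGrid` (§2), definitionally. -/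
theorem voronoiGrid_of_stub : VoronoiGrid := stub_voronoiGrid

/-! ### §4 The composition (concludes the crux BY NAME; no `sorry` outside the stubs) -/

/-- A point of an open arc of `forgetLast R` lies in `closure Ω` (it is a boundary point). -/
theorem mem_closure_of_mem_openArc {R : ConformalRectangle} {i : Fin 3} {z : ℂ}
    (hz : z ∈ (forgetLast R).boundary '' Ioo ((forgetLast R).mark i) ((forgetLast R).nextMark i)) :
    z ∈ closure R.carrier := by
  obtain ⟨t, -, rfl⟩ := hz
  exact frontier_subset_closure ((forgetLast R).boundary_mem_frontier t)

/-- **The canonical annealed Voronoi data are separating data** (the Voronoi counterpart of the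
tree's `isSeparatingData_of_discreteApprox`, Bollobás–Riordan §7.2.6): `mem_Icc` because `vorSep`
is a probability, `dense` / `interior` from the grid, `equicontinuous` from the Claim-22 estimate
restricted to the grid (`S_δ ⊆ closure Ω`), `cauchy` = the kernel, `boundary` from the two
Claim-23 estimates read along the face-centre sequence of `exists_hexCenter_seq_tendsto` (which
lies in `Ω`, hence in the grid). Sorry-free glue. -/
theorem voronoi_isSeparatingData (hK : VoronoiCauchy) (hE : VoronoiEquicont)
    (hBv : VoronoiBoundaryVanish) (hBs : VoronoiBoundarySum)
    {PB PW : Measure (PointConfig ℂ)} (hB : IsPoissonPointProcess (volume : Measure ℂ) PB)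
    (hW : IsPoissonPointProcess (volume : Measure ℂ) PW) {R : ConformalRectangle} {a b c d : ℂ}
    {ψ : ConformalEquiv R.carrier (openTriangle a b c)} (habc : IsEquilateral a b c)
    (hd : d ∈ openSegment ℝ c a) (hψ : IsCarlesonMap R a b c d ψ) {S : ℝ → Finset ℂ}
    (hS1 : ∀ δ, ∀ w ∈ S δ, w ∈ closure R.carrier)
    (hS2 : ∀ δ : ℝ, 0 < δ → ∀ x : HexVertex,
      (δ : ℂ) * hexCenter x ∈ closure R.carrier → (δ : ℂ) * hexCenter x ∈ S δ)
    (hS3 : ∃ ε : ℝ → ℝ, Tendsto ε (𝓝[>] 0) (𝓝 0) ∧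
      ∀ᶠ δ in 𝓝[>] (0 : ℝ), ∀ z ∈ closure R.carrier, ∃ w ∈ S δ, dist z w ≤ ε δ) :
    IsSeparatingData R (triangleTurn a b c) S (vorSep PB PW R) where
  mem_Icc δ i w _ := by
    haveI := hB.isProbabilityMeasure
    haveI := hW.isProbabilityMeasure
    exact ⟨measureReal_nonneg, measureReal_le_one⟩
  dense := hS3
  interior K _ hKΩ := by
    filter_upwards [self_mem_nhdsWithin] with δ hδ x hx
    exact hS2 δ hδ x (subset_closure (hKΩ hx))
  equicontinuous β hβ := by
    obtain ⟨η, hη, h⟩ := hE PB PW hB hW R β hβ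
    exact ⟨η, hη, h.mono fun δ hδ i z hz w hw hzw => hδ i z (hS1 δ z hz) w (hS1 δ w hw) hzw⟩
  cauchy := hK PB PW hB hW R a b c d ψ habc hd hψ
  boundary i z hz := by
    obtain ⟨zs, hzs, hzt⟩ := exists_hexCenter_seq_tendsto R (mem_closure_of_mem_openArc hz)
    have hzs' : ∀ᶠ δ : ℝ in 𝓝[>] 0, (δ : ℂ) * hexCenter (zs δ) ∈ closure R.carrier :=
      hzs.mono fun δ hδ => subset_closure hδ
    refine ⟨fun δ => (δ : ℂ) * hexCenter (zs δ), ?_, hzt,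
      hBv PB PW hB hW R i z hz _ hzs' hzt, hBs PB PW hB hW R i z hz _ hzs hzt⟩
    filter_upwards [hzs, self_mem_nhdsWithin] with δ hδ hpos
    exact ⟨hS2 δ hpos _ (subset_closure hδ), hδ⟩

/-- **Annealed Voronoi separating data from the v7 statements** (the Voronoi counterpart of the
tree's `smirnov_separatingData_of_discreteApprox`): both systems of data are the canonical ones on
the grid, the sandwich points are face centres `z_δ → d'` in `Ω` (`exists_hexCenter_seq_tendsto`)
and the error is `|vorCross δ - f_δ¹(z_δ)| → 0` by (40). Sorry-free glue. -/
theorem voronoiSepData_of (hK : VoronoiCauchy) (hE : VoronoiEquicont) (hBv : VoronoiBoundaryVanish)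
    (hBs : VoronoiBoundarySum) (hC : VoronoiCorner) (hG : VoronoiGrid) : VoronoiSepData := by
  intro PB PW hB hW R a b c d ψ habc hd hψ
  obtain ⟨S, hS1, hS2, hS3⟩ := hG R
  have hD : IsSeparatingData R (triangleTurn a b c) S (vorSep PB PW R) :=
    voronoi_isSeparatingData hK hE hBv hBs hB hW habc hd hψ hS1 hS2 hS3
  obtain ⟨zs, hzs, hzt⟩ := exists_hexCenter_seq_tendsto R
    (frontier_subset_closure (R.pt_mem_frontier 3))
  have hlim := hC PB PW hB hW R _ (hzs.mono fun δ hδ => subset_closure hδ) hzt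
  refine ⟨S, S, vorSep PB PW R, vorSep PB PW R, hD, hD,
    fun δ => (δ : ℂ) * hexCenter (zs δ), fun δ => (δ : ℂ) * hexCenter (zs δ),
    fun δ => |vorCross PB PW R δ - vorSep PB PW R δ 1 ((δ : ℂ) * hexCenter (zs δ))|,
    ?_, hzt, hzt, ?_, ?_⟩
  · filter_upwards [hzs, self_mem_nhdsWithin] with δ hδ hpos
    exact ⟨hS2 δ hpos _ (subset_closure hδ), hδ, hS2 δ hpos _ (subset_closure hδ), hδ⟩
  · simpa using hlim.abs
  · filter_upwards with δ
    have h1 := le_abs_self (vorCross PB PW R δ - vorSep PB PW R δ 1 ((δ : ℂ) * hexCenter (zs δ)))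
    have h2 := neg_abs_le (vorCross PB PW R δ - vorSep PB PW R δ 1 ((δ : ℂ) * hexCenter (zs δ)))
    constructor <;> linarith

/-- The Voronoi Smirnov sandwich from the generic passage and the Voronoi data. -/
theorem voronoiMorera_of (hF : FamiliesOfData) (hV : VoronoiSepData) : VoronoiMorera :=
  fun PB PW hB hW R a b c d ψ habc hd hψ => hF R a b c _ (hV PB PW hB hW R a b c d ψ habc hd hψ)

/-- The `G_s` Smirnov sandwich from the generic passage and the `G_s` data. -/
theorem gsMorera_of (hF : FamiliesOfData) (hG : GsSepData) : GsMorera :=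
  fun R a b c d ψ habc hd hψ => hF R a b c _ (hG R a b c d ψ habc hd hψ)

/-- The dictionary transports the crude crossing functional to tree vocabulary. -/
theorem gsCross_eq_gsCrossTree (hD : GsDictionary) (R : ConformalRectangle) :
    gsCross R = gsCrossTree R := by
  funext δ
  simp only [gsCross, gsCrossTree, centredSquareCrossing]
  rw [show gsGraph = centredSquareGraph from hD]

/-- Conjunct (i) from the endgame and the Voronoi sandwich (sorry-free glue). -/
theorem voronoiCardy_of (hE : Endgame) (hV : VoronoiMorera) : VoronoiCardy :=
  fun PB PW hB hW R => hE R _ (hV PB PW hB hW R)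

/-- Conjunct (ii) from the endgame, the dictionary and the `G_s` sandwich (sorry-free glue). -/
theorem gsCardy_of (hE : Endgame) (hD : GsDictionary) (hG : GsMorera) : GsCardy := by
  intro R
  rw [gsCross_eq_gsCrossTree hD R]
  exact hE R _ (hG R)

/-- The crux from the statements (sorry-free glue, hypotheses = the stub statements). -/
theorem target_of_statements (hE : Endgame) (hF : FamiliesOfData) (hK : VoronoiCauchy)
    (hEq : VoronoiEquicont) (hBv : VoronoiBoundaryVanish) (hBs : VoronoiBoundarySum)
    (hC : VoronoiCorner) (hG : VoronoiGrid) (hD : GsDictionary) (hGs : GsSepData) :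
    Theses.CardyFlipRusso.Target :=
  target_iff.2 ⟨voronoiCardy_of hE (voronoiMorera_of hF (voronoiSepData_of hK hEq hBv hBs hC hG)),
    gsCardy_of hE hD (gsMorera_of hF hGs)⟩

/-- **`Target` from the Smirnov pipeline of line `Sketch`** (v7.1; the conditional Voronoi pipeline, second composition of this file): the kernel (3a), the
Claim-22 estimate (3b, from F1/F2 = 3f), the two Claim-23 estimates (3c′ from F1, 3c″), (40)
(3d, from F1) and the grid (3e, landed) give annealed Voronoi separating data; separating data give
Smirnov families (stub 2, landed) and the endgame (stub 1, landed) gives conjunct (i); conjunct (ii)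
comes, as in §0, from stmt-4558 BY NAME through the Union-Jack endgame and the bridge. No hypotheses:
the only `sorry`s in its cone are `stub_voronoiCauchy`, `stub_tassionEstimates`,
`stub_voronoiBoundarySum`, `stub_open_unionJackMorera`, `stub_gsCardyOfUnionJack`. -/
theorem Target_of_sketch : Theses.CardyFlipRusso.Target :=
  ⟨voronoiCardy_of stub_endgame (voronoiMorera_of stub_familiesOfData
      (voronoiSepData_of stub_voronoiCauchy voronoiEquicont_of_stub voronoiBoundaryVanish_of_stub
        voronoiBoundarySum_of_stub voronoiCorner_of_stub stub_voronoiGrid)),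
    stub_gsCardyOfUnionJack
      (Summit.CriticalPhenomena.CardyFormulaZ2.Theorems.unionJackEndgame_proof stub_open_unionJackMorera)⟩

/-- The fact stub IS `VoronoiAnnealedOneArm ∧ VoronoiAnnealedBlackCircuit`, the two Literature
named facts (Tassion 2016), definitionally. -/
theorem tassionEstimates_of_stub : VoronoiAnnealedOneArm ∧ VoronoiAnnealedBlackCircuit :=
  stub_tassionEstimates

/-! ### §5 Structural facts for the planner (v6, cycle 3; sorry-free, independent of the stubs 3a–3d, 5)

An `IsSeparatingData`-EXISTENTIAL interface is never smaller than the conjunct it feeds: Cardy's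
formula for a crossing functional `p` of `R` already yields two systems of separating data
sandwiching `p`, by BORROWING the tree's proved triangular data and enlarging their error by
`|p δ - triDomainCrossingProb R δ|`, which tends to `0` because both functionals tend to `F(η)` for
one and the same uniformizing datum of `R`. Consequences: `GsSepData ↔ GsCardy` — stub 5 IS
conjunct (ii) (hence exactly as hard as the shared crux `UnionJackMorera`, stmt-CriticalPhenomena-4558,
modulo the embedding bridge of lead 0's evidence `GsUnionJackDictionary.lean`) — and
`VoronoiSepData ↔ VoronoiCardy` (the v4 interface IS conjunct (i)); only the canonical data `vorSep`
of v5 carry more than the conjunct, and their kernel `stub_voronoiCauchy` is the conjecture itself in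
Cauchy–Riemann form. These use only landed stubs (1, 2, 4) and proved Literature facts. -/

/-- **Borrowing the triangular data.** If a crossing functional `p` of the conformal rectangle `R`
has crossing limit `cardyFunction`, then for every Carleson datum `(a, b, c, d, ψ)` of `R` the
PROVED triangular separating data (`smirnov_exists_separatingData_holds`, Bollobás–Riordan Ch. 7
§7.2.6) sandwich `p` as well, with the error enlarged by `|p δ - triDomainCrossingProb R δ| → 0`
(`p` and `triDomainCrossingProb R` both tend to `F(crossRatio x)` for a uniformizing datum `(φ, x)`
of `R`, which exists by `MarkedDomain.exists_isUniformizing_holds`; Smirnov's theorem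
`hasCrossingLimit_triDomainCrossingProb_holds`). -/
theorem sepDataSandwich_of_hasCrossingLimit {R : ConformalRectangle} {p : ℝ → ℝ}
    (hp : R.HasCrossingLimit p Literature.Probability.RandomPlanarGeometry.cardyFunction)
    {a b c d : ℂ} {ψ : ConformalEquiv R.carrier (openTriangle a b c)} (habc : IsEquilateral a b c)
    (hd : d ∈ openSegment ℝ c a) (hψ : IsCarlesonMap R a b c d ψ) : SepDataSandwich R a b c p := by
  obtain ⟨Sm, Sp, fm, fp, hDm, hDp, zm, zp, e, hmem, hzm, hzp, he, hsand⟩ :=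
    smirnov_exists_separatingData_holds R a b c d ψ habc hd hψ
  obtain ⟨φ, x, hφ⟩ := MarkedDomain.exists_isUniformizing_holds R
  have h1 : Tendsto p (𝓝[>] 0)
      (𝓝 (Literature.Probability.RandomPlanarGeometry.cardyFunction (crossRatio x))) := hp φ x hφ
  have h2 : Tendsto (triDomainCrossingProb R) (𝓝[>] 0)
      (𝓝 (Literature.Probability.RandomPlanarGeometry.cardyFunction (crossRatio x))) :=
    hasCrossingLimit_triDomainCrossingProb_holds R φ x hφ
  have hdiff : Tendsto (fun δ => |p δ - triDomainCrossingProb R δ|) (𝓝[>] 0) (𝓝 0) := by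
    simpa using (h1.sub h2).abs
  refine ⟨Sm, Sp, fm, fp, hDm, hDp, zm, zp, fun δ => e δ + |p δ - triDomainCrossingProb R δ|,
    hmem, hzm, hzp, by simpa using he.add hdiff, ?_⟩
  filter_upwards [hsand] with δ hδ
  have h3 := le_abs_self (p δ - triDomainCrossingProb R δ)
  have h4 := neg_abs_le (p δ - triDomainCrossingProb R δ)
  constructor <;> linarith [hδ.1, hδ.2]

/-- **Conjunct (ii) gives the `G_s` separating data** (the converse of the line's
`gsCardy_of ∘ gsMorera_of`): stub 5 is implied by the statement it serves. -/
theorem gsSepData_of_gsCardy (hD : GsDictionary) (hG : GsCardy) : GsSepData := by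
  intro R a b c d ψ habc hd hψ
  have hp : R.HasCrossingLimit (gsCrossTree R)
      Literature.Probability.RandomPlanarGeometry.cardyFunction := by
    rw [← gsCross_eq_gsCrossTree hD R]
    exact hG R
  exact sepDataSandwich_of_hasCrossingLimit hp habc hd hψ

/-- **Stub 5 IS conjunct (ii)**: `GsSepData ↔ GsCardy`, sorry-free over the landed stubs 1
(`stub_endgame`), 2 (`stub_familiesOfData`) and 4 (`stub_gsDictionary`). So the `G_s` half of this
line is exactly as hard as Cardy's formula for critical site percolation on the centred square
lattice (the shared crux `UnionJackBeffara.UnionJackMorera`, stmt-CriticalPhenomena-4558, up to the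
`O(δ)` embedding shift / `2δ` vs `2√2 δ` tolerance bridge recorded in `GsUnionJackDictionary.lean`). -/
theorem gsSepData_iff_gsCardy : GsSepData ↔ GsCardy :=
  ⟨fun h => gsCardy_of stub_endgame stub_gsDictionary (gsMorera_of stub_familiesOfData h),
    gsSepData_of_gsCardy stub_gsDictionary⟩

/-- **Conjunct (i) gives annealed Voronoi separating data** (the converse of
`voronoiCardy_of ∘ voronoiMorera_of`): the v4 (D′)-existential interface is implied by the
statement it serves. -/
theorem voronoiSepData_of_voronoiCardy (hV : VoronoiCardy) : VoronoiSepData :=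
  fun PB PW hB hW R _ _ _ _ _ habc hd hψ =>
    sepDataSandwich_of_hasCrossingLimit (hV PB PW hB hW R) habc hd hψ

/-- **The (D′)-existential Voronoi interface IS conjunct (i)**: `VoronoiSepData ↔ VoronoiCardy`,
sorry-free over the landed stubs 1 and 2. Only the CANONICAL data `vorSep` (stubs 3a–3d of v5) say
more: `stub_voronoiCauchy` asserts the discrete Cauchy estimate for specific percolation
probabilities, not an existential. -/
theorem voronoiSepData_iff_voronoiCardy : VoronoiSepData ↔ VoronoiCardy :=
  ⟨fun h => voronoiCardy_of stub_endgame (voronoiMorera_of stub_familiesOfData h),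
    voronoiSepData_of_voronoiCardy⟩

/-- **The crux IS the conjunction of the two (D′)-existential interfaces** (sorry-free): useful to
the planner for splitting `Target` (the route's `closes` consumes only conjunct (ii), `Target.2`)
and for deduplicating conjunct (ii) onto the `UnionJackBeffara` items. -/
theorem target_iff_sepData : Theses.CardyFlipRusso.Target ↔ VoronoiSepData ∧ GsSepData := by
  rw [target_iff, voronoiSepData_iff_voronoiCardy, gsSepData_iff_gsCardy]

end Summit.CriticalPhenomena.CardyFormulaZ2.Cruxes.Target.Sketch

end

#h21_check_skeleton "stmt-CriticalPhenomena-6431" Summit.CriticalPhenomena.CardyFormulaZ2.Theses.CardyFlipRusso.Target stub_open_voronoiHubFromSmirnov stub_open_unionJackMorera stub_gsCardyOfUnionJack stub_voronoiCauchy stub_tassionEstimates stub_voronoiExclusion
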